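import Literature.MathematicalPhysics.QuantumLattice.TorusSectorGibbsEnergyWindow
import Literature.MathematicalPhysics.QuantumLattice.ApproximatingHamiltonianProofs
import Literature.MathematicalPhysics.QuantumLattice.HubbardTTPrimeHoppingSupergradient
import Literature.MathematicalPhysics.QuantumLattice.TorusLimitOfMixturesCompactness
import Literature.MathematicalPhysics.QuantumLattice.HubbardTTPrimeDiagHopTransport
import HarnessLib

/-!
# `t'`-direction transport rows at positive temperature (torus-limit thermal convention):
# existence of thermal torus limits, the thermal diagonal-hopping word is antitone in `t'`,
# BOX ⇒ WORD and anchor-cap transport on `(t'-box) × (T ≤ T₀)` cells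

Family `hubbard` (topic `MathematicalPhysics/QuantumLattice`). The `T > 0` twin of
`HubbardTTPrimeDiagHopTransport.lean` (the `T = 0` rows by which words certified at finitely many
next-nearest-neighbour hoppings cover a whole interval `t' ∈ [s₁, s₂]`), written for stage S2 of the
Hubbard material-oracle programme («robustness lemmas consumed by S2 … so a parameter BOX maps to a
certified word», `T > 0` leg; the phase map's cells are `T × couplings`). The thermal state class is the
tree's TORUS-LIMIT THERMAL CONVENTION of `TorusSectorGibbsMixture` / `TorusSectorGibbsEnergyWindow`: the
equilibrium state of the `t–t'` Hubbard model at `(β, n)` is a torus limit `ω`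
(`InfVolFermionState.IsTorusLimitOfMixture`) of the CANONICAL GIBBS STATES `ρ_{L,β} = e^{-βH_L(t,t',U)|_sec}/Z`
on the `(rectN n L, S^z = 0)` sector of the `L × L` torus. Notation: `e(s) = energyDensityTT' t s U n`,
`e_Φ(ω) = ω.meanEnergy Φ 1`, `Φ(t,s,U) = hubbardTTPrimeFermionInteraction t s U`,
`K₂(ω) = e_{Φ(0,1,0)}(ω)` (diagonal-hopping energy per site; the engine's `HOP2 = −K₂`), `H_b` =
Mathlib's `Real.binEntropy` (so `2H_b(n/2)` is the sector entropy density bound `s_max(n)`).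

§1 (general linear algebra) `re_gibbsState_submatrix_eq_sum_canonicalWeight`: for a Hermitian `A` and
any `X` with no entries from the complement of a coordinate sector into it, the Gibbs expectation of the
compression `X|_sec` in the Gibbs state of `A|_sec` is the canonical MIXTURE `Σ_a w_a Re⟨ψ_a, X ψ_a⟩` over
the extended sector eigenvectors of `A` (generalises `re_gibbsState_sectorHamiltonianTT'`, the case
`X = A`) — the bridge between the matrix thermal toolkit (`Matrix.gibbsState`) and the mixture format
of `IsTorusLimitOfMixture`.
§2 (finite volume) the sector Hamiltonian is affine in `t'` (`sectorHamiltonianTT'_eq_add_smul_tPrime`);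
the sector Gibbs expectation at another coupling in mixture form
(`re_gibbsState_sectorHamiltonianTT'_coupling`); the two Peierls–Bogoliubov tangents of the concave
free energy `s ↦ −β⁻¹ log Z_{L,β}(t,s,U)` (the tree's `log_partitionFn_sub_le_log_partitionFn_add`,
cf. `GibbsFreeEnergyCouplingConcavity.log_partitionFn_sub_mem_Icc`) give: the THERMAL `K₂`-MEAN
`Σ_i p_{L,i}(s) Re⟨ψ_{L,i}(s), H_L(0,1,0) ψ_{L,i}(s)⟩` IS ANTITONE IN `s = t'` at every `β > 0`
(`sectorGibbs_diagHopMean_anti_tPrime`), and the free-energy increments are bracketed,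
`β(s₂−s₁)⟨K⟩_{s₂} ≤ log Z_L(s₁) − log Z_L(s₂) ≤ β(s₂−s₁)⟨K⟩_{s₁}` (`log_partitionFn_sector_sub_mem_Icc_tPrime`;
the `T > 0` twin of `B(s′−s) ≤ e(s′) − e(s) ≤ A(s′−s)`).
§3 (thermodynamic limit, common tori) `IsTorusLimitOfMixture.meanEnergy_diagHop_anti_of_sectorGibbs`:
torus limits `ω₁`, `ω₂` of the sector Gibbs states at `s₁ ≤ s₂` (same `β > 0`, same `Ls → ∞`) satisfy
`K₂(ω₂) ≤ K₂(ω₁)` — the coupling-axis companion of the `β`-axis row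
`…meanEnergy_hubbardTTPrime_anti_of_sectorGibbs`, and the `T > 0` twin of
`IsTorusLimitOf.diagHopEnergy_anti_of_groundStates`.
§4 EXISTENCE: by the compactness theorem for mixtures
(`InfVolFermionState.exists_isTorusLimitOfMixture_subseq`, `TorusLimitOfMixturesCompactness`) TORUS-LIMIT
THERMAL STATES OF THE `t–t'` HUBBARD MODEL EXIST along a subsequence of every `Ls → ∞`, at every
`(β, t, t', U, 0 ≤ n ≤ 2)` (`exists_isTorusLimitOfMixture_sectorGibbs`) — the «for every thermal torus
limit» rows of the convention are never vacuous, and §5 uses it to compare states along arbitrary tori.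
§5 BOX ⇒ WORD at `T > 0` along ANY tori: a `K₂`-ceiling word certified for every thermal torus limit at
`(β, s₁)` holds for every thermal torus limit at every `s ≥ s₁`
(`…meanEnergy_diagHop_le_of_forall_left_of_sectorGibbs`: extract a torus limit at `s₁` along the given
tori by §4, compare by §3), floor words move left (`…le_meanEnergy_diagHop_of_forall_right_of_sectorGibbs`),
so the two ENDPOINT words bracket `K₂` on the whole box (`…_mem_Icc_of_forall_endpoints_of_sectorGibbs`).
§6 THERMAL CAP TRANSPORT. A thermal torus limit `ω` at `(β, s)` sits, for the ANCHOR Hamiltonian at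
`s₀`, in the window `e(s₀) ≤ e_{Φ(t,s₀,U)}(ω) ≤ e(s₀) + 2H_b(n/2)/β + (s − s₀)(K₂(ω₀) − K₂(ω))` (`ω₀` any
torus-limit ground state at `s₀`; `…meanEnergy_anchor_le_of_groundState_of_sectorGibbs`) — kinematic
form `≤ e(s₀) + 2H_b(n/2)/β + (32/π²)|s − s₀|` (`…meanEnergy_anchor_mem_Icc_kinematic_of_sectorGibbs`),
word forms `≤ u₀ + 2H_b(n/2)/β + (s − s₀)(A₀ − B₂)` right of the anchor (ground-state ceiling `A₀` at
`s₀`, thermal floor `B₂` at `s₂`) and `(s₀ − s)(A₁ − B₀)` left of it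
(`…meanEnergy_anchor_le_of_words_right/left_of_sectorGibbs`). Hence **one eom-free CAP-CLASS
certificate at the anchor words the whole `(t'-box) × (T ≤ 1/β)` cell**: a property `P` certified for
every torus limit of probability mixtures of unit `rectN n L`-particle vectors under the anchor cap
`e_{Φ(t,s₀,U)}(ω) ≤ u` holds for EVERY thermal torus limit at EVERY `s ∈ [s₁, s₂]` and EVERY `β' ≥ β`
once the cap is booked as `u ≥ u₀ + 2H_b(n/2)/β + (32/π²)·max(s₂ − s₀, s₀ − s₁)`
(`forall_sectorGibbsLimit_tPrime_box_of_forall_cap_kinematic`), or, at fixed `β`, with the word price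
`max(0, (s₂ − s₀)(A₀ − B₂), (s₀ − s₁)(A₁ − B₀))` (`forall_sectorGibbsLimit_tPrime_box_of_forall_cap`).
The `T > 0` twins of `forall_groundState_tPrime_box_of_forall_cap(_kinematic)`; the extra term is the
entropy price `T·s_max(n)` of the torus-limit thermal convention's energy–entropy cap.
§7 the thermal ENERGY WINDOW on a `t'`-box × `[β, ∞)` from two endpoint floors and one anchor cap of the
ground-state energy density (`…meanEnergy_hubbardTTPrime_mem_Icc_on_tPrime_box_of_sectorGibbs`).
§8 FREE-ENERGY (`log Z`) TRANSPORT ALONG `t'` (finite volume, inputs of the chords of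
`TorusSectorGibbsEnergyWindow` §2): the finite-volume kinematic row `|Re⟨ψ, H_L(0,1,0) ψ⟩| ≤ 4N` for unit
`N`-particle vectors (`abs_re_expect_hubbardTorusTT'_diagHop_unit_le`, Lieb–Loss' Fermi sea at `μ = −4`) and
its mixture form (`abs_sectorGibbs_diagHopMean_le`); the Lipschitz bound
`|log Z_L(β,t,s₁,U) − log Z_L(β,t,s₂,U)| ≤ 4β·rectN n L·|s₁ − s₂|` (`abs_log_partitionFn_sector_sub_le_tPrime`);
hence eventual per-volume inputs move across the box at the price `4βn|s − s₀|` per site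
(`eventually_mul_sq_le_log_partitionFn_sector_of_tPrime`, `eventually_log_partitionFn_sector_le_mul_sq_of_tPrime`)
and the HOT CHORD holds on the whole box from inputs at ONE anchor
(`IsTorusLimitOfMixture.meanEnergy_hubbardTTPrime_le_chord_of_anchor_inputs`:
`e_{Φ(t,s,U)}(ω) ≤ (u_h + 4β_h n|s−s₀| − ℓ + 4βn|s−s₀|)/(β − β_h)`).
§9 CERTIFIED THERMAL WORDS ARE EVENTUAL FINITE-VOLUME SLOPES (compactness again): a thermal `K₂`-ceiling
(floor) word at `(β, s)` bounds the finite-volume thermal `K₂`-means by `(A + ε)L²` (`(B − ε)L²`) eventually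
along every `Ls → ∞` (`eventually_sectorGibbs_diagHopMean_le_of_forall`, `eventually_le_sectorGibbs_diagHopMean_of_forall`),
so free-energy lower inputs move right/left of the anchor at the CERTIFIED price `β(s − s₀)(A₀ + ε)` /
`β(s₀ − s)(ε − B₀)` (`eventually_mul_sq_le_log_partitionFn_sector_of_word_right/left`).
§10 UPPER INPUTS AND THE KINEMATIC PRICE `16/π²`: free-energy UPPER inputs `log Z_{L,β}(t,s₀,U) ≤ u·L²` move
across the box with thermal `K₂` words at the FAR side of the target (Peierls–Bogoliubov at the target:
`eventually_log_partitionFn_sector_le_mul_sq_of_word_right/left`); since `∓16/π²` are thermal words at EVERY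
`(β, s)` (`IsTorusLimitOfMixture.abs_meanEnergy_diagHop_le_of_sectorGibbs`), the finite-volume thermal
`K₂`-means are eventually within `±(16/π² + ε)L²` (`eventually_sectorGibbs_diagHopMean_le_sixteen_div_pi_sq`,
`eventually_neg_sixteen_div_pi_sq_le_sectorGibbs_diagHopMean`), both inputs move in both directions at the price
`β(16/π² + ε)|s − s₀|` per site (`eventually_mul_sq_le_log_partitionFn_sector_of_tPrime_sixteen_div_pi_sq`,
`eventually_log_partitionFn_sector_le_mul_sq_of_tPrime_sixteen_div_pi_sq`) — versus §8's `4βn|s − s₀|`, i.e.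
`1.62` against `3.5` per unit `β|Δt'|` at `n = 7/8` — and the hot chord holds on the whole box at that price,
`e_{Φ(t,s,U)}(ω) ≤ (u_h − ℓ + (β + β_h)(16/π²)|s − s₀|)/(β − β_h)`
(`IsTorusLimitOfMixture.meanEnergy_hubbardTTPrime_le_chord_of_anchor_inputs_sixteen_div_pi_sq`, `ε`-free).

Everything is PROVED; no definition, no named fact, no numerical input. HONEST SCOPE: no statement
about the thermodynamic limit of the free energy density itself (Israel's Thm. I.3.4 is not touched —
§3/§5 go through common tori and compactness instead); thermal `K₂` words at `(β, s)` do not transfer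
to other temperatures (no monotonicity of `K₂` in `β`), which is why the cell theorem over a temperature
RANGE is the kinematic one; finite-volume grand-canonical statements (joint concavity of
`−β⁻¹ log tr e^{−β(H − μN)}` in all couplings) are `GibbsFreeEnergyCouplingConcavity` and its Hubbard
companion, not this file. WHAT THIS IS NOT: no number, no certificate, no phase sentence — transport
lemmas (the certified side of the SYSTEMATIC → CERTIFIED seam) only.

## References

* R. B. Israel, *Convexity in the Theory of Lattice Gases* (1979), Lemma II.3.1 (finite-volume
  variational principle; Gibbs states with periodic boundary conditions §I.3 eq. (26)).
  [cite: Israel1979, Lemma II.3.1]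
* E. H. Lieb, *The classical limit of quantum spin systems*, Commun. Math. Phys. 31 (1973) 327–340,
  §V (5.2)–(5.4) (`λ⟨A⟩_{H+λA} ≤ f(0) − f(λ)`-type Peierls–Bogoliubov brackets). [cite: Lieb1973, §V (5.2)–(5.4)]
* D. Ruelle, *Statistical Mechanics: Rigorous Results* (1969), §2.5 (convexity inequalities for
  `log tr e^{A}`), §3.4. [cite: Ruelle1969, §2.5]
* O. Bratteli, D. W. Robinson, *Operator Algebras and Quantum Statistical Mechanics 1*, 2nd ed. (1987),
  Thm. 2.3.15 (weak-⋆ compactness of the state space) and §4.3.1. [cite: BratteliRobinsonI1987, Thm. 2.3.15 (weak-⋆ compactness of the state space) and §4.3.1]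
* E. H. Lieb, M. Loss, Duke Math. J. 71 (1993) 337, §8 Thm. 8.2 (kinematic hopping bounds).
  [cite: LiebLoss1993, §8, Theorem 8.2]

## Mathlib / tree search

REUSED (not restated): `sectorHamiltonianTT'`, `isHermitian_sectorHamiltonianTT'`, `nonempty_szConfig`,
`re_gibbsState_sectorHamiltonianTT'` (template), the whole `TorusSectorGibbsMixture` API
(`sectorExtend/Eigenvalue/Eigenvector`, `canonicalWeight`, `sectorGibbsCount/Index/WeightTT'/VectorTT'`,
`hubbardTorusTT'_apply_eq_zero_of_szConfig`, `…_nonneg`, `sum_…`, `isNParticle_…`, `star_…_dotProduct_self`,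
`IsTorusLimitOfMixture.meanEnergy_hubbardTTPrime_le_energyDensityTT'_add_binEntropy_div`,
`…energyDensityTT'_le_meanEnergy_of_sectorGibbs`, `…abs_meanEnergy_diagHop_le_of_sectorGibbs`),
`IsTorusLimitOfMixture.tendsto_meanEnergy_hubbardTTPrime` (`TorusLimitOfMixtures`),
`Matrix.IsHermitian.re_gibbsState`, `….gibbsWeight_eq`, `trace_unitary_conj_mul` (`DuhamelTwoPoint`),
`log_partitionFn_sub_le_log_partitionFn_add` (`ApproximatingHamiltonianProofs`; Peierls–Bogoliubov in log
form), `TTPrimeFree.hubbardTorusTT'_eq_add_smul_diagHop`, `….hubbardTorusTT'_tzero_Uzero`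
(`HubbardTTPrimeHoppingSupergradient`), `meanEnergy_hubbardTTPrime_affine`,
`IsTorusLimitOf.energyDensityTT'_le_affine` (`HubbardTTPrimeMeanEnergySupergradient`),
`exists_isTorusLimitOf_sectorGroundState_TT'` (`HubbardNNNHoppingTorusLimitCorrelator`), the compactness
theorem for mixtures `InfVolFermionState.exists_isTorusLimitOfMixture_subseq` and
`IsTorusLimitOfMixture.comp_tendsto` (`TorusLimitOfMixturesCompactness`), and the `T = 0`
rows `energyDensityTT'_le_of_upperBound_tPrime_kinematic`, `energyDensityTT'_ge_min_of_mem_Icc_tPrime`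
(`HubbardTTPrimeDiagHopTransport`); for §8–§9 `TTPrimeFree.le_groundEnergy_hubbardTorusTT'` (`HubbardTTPrimeFreeKineticBound`),
`LiebThm1.groundEnergy_le_re_expect`, `ThermodynamicLimit.rectN_le(_two_mul)`, the hot chord
`IsTorusLimitOfMixture.meanEnergy_hubbardTTPrime_le_chord_of_sectorGibbs` (`TorusSectorGibbsEnergyWindow`), Mathlib
`Filter.extraction_of_frequently_atTop`. NOTE (found after §1–§7 landed): the complex-valued form of the §1/§2
mixture ↔ `gibbsState` bridge is `sum_canonicalWeight_mul_expect_sectorEigenvector_eq_gibbsState` /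
`sum_sectorGibbsWeightTT'_mul_expect_eq_gibbsState` (`TorusSectorGibbsScaleCovariance`, landed the same hour);
§1–§2 here are its real-part forms. The private `sectorExtend` bookkeeping lemmas of
`TorusSectorGibbsMixture` are not exported, hence the four private copies in §1.
`lean search 'diagHop.*anti.*sectorGibbs|sectorGibbs.*tPrime|anchor.*sectorGibbs' --decl`: nothing — no
coupling-axis monotonicity / transport row for the thermal convention was in the tree (its `β`-axis row is
`TorusSectorGibbsEnergyWindow` §3; the finite-volume grand-canonical coupling calculus is
`GibbsFreeEnergyCouplingConcavity`).
-/

noncomputable section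

namespace Literature.MathematicalPhysics.QuantumLattice

open Matrix Finset HubbardWave0 Literature.Probability.LatticeModels ThermodynamicLimit
open _root_.Filter
open scoped _root_.Topology ComplexOrder BigOperators

/-! ### §1 Mixture form of the Gibbs expectation of a sector-preserving observable -/

section General

variable {ι : Type*} [Fintype ι] [DecidableEq ι] (p : ι → Prop) [DecidablePred p]

omit [Fintype ι] [DecidableEq ι] in
/-- `sectorExtend` on a coordinate of the sector. [folklore] -/
private theorem sectorExtend_val (φ : Subtype p → ℂ) (a : Subtype p) :
    sectorExtend p φ a.1 = φ a := by
  simp [sectorExtend, a.2]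

omit [Fintype ι] [DecidableEq ι] in
/-- `sectorExtend` vanishes off the sector. [folklore] -/
private theorem sectorExtend_of_not {i : ι} (hi : ¬ p i) (φ : Subtype p → ℂ) :
    sectorExtend p φ i = 0 := by
  simp [sectorExtend, hi]

omit [DecidableEq ι] in
/-- A sum of a function vanishing off `p` is the sum over `Subtype p`. [folklore] -/
private theorem sum_eq_sum_subtype_of_vanish' (f : ι → ℂ) (hf : ∀ i, ¬ p i → f i = 0) :
    ∑ i, f i = ∑ a : Subtype p, f a.1 := by
  rw [← Finset.sum_subtype (Finset.univ.filter p) (by simp), Finset.sum_filter_of_ne]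
  intro i _ hi
  by_contra h
  exact hi (hf i h)

omit [DecidableEq ι] in
/-- `⟨ext φ, w⟩ = ⟨φ, w|_p⟩`. [folklore] -/
private theorem star_sectorExtend_dotProduct' (φ : Subtype p → ℂ) (w : ι → ℂ) :
    star (sectorExtend p φ) ⬝ᵥ w = star φ ⬝ᵥ fun a : Subtype p => w a.1 := by
  rw [dotProduct, dotProduct, sum_eq_sum_subtype_of_vanish' p]
  · refine Finset.sum_congr rfl fun a _ => ?_
    rw [Pi.star_apply, Pi.star_apply, sectorExtend_val]
  · intro j hj
    rw [Pi.star_apply, sectorExtend_of_not p hj, star_zero, zero_mul]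

omit [DecidableEq ι] in
/-- A matrix with no entries from the sector to its complement acts on extended vectors as its
compression: `X (ext φ) = ext (X|_p φ)`. [folklore] -/
private theorem mulVec_sectorExtend' {X : Matrix ι ι ℂ} (hinv : ∀ i j, ¬ p i → p j → X i j = 0)
    (φ : Subtype p → ℂ) :
    X *ᵥ sectorExtend p φ =
      sectorExtend p (X.submatrix (Subtype.val : Subtype p → ι) Subtype.val *ᵥ φ) := by
  funext i
  rw [mulVec, dotProduct]
  by_cases hi : p i
  · rw [show sectorExtend p (X.submatrix (Subtype.val : Subtype p → ι) Subtype.val *ᵥ φ) i =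
        (X.submatrix (Subtype.val : Subtype p → ι) Subtype.val *ᵥ φ) ⟨i, hi⟩ from
      sectorExtend_val p _ ⟨i, hi⟩, mulVec, dotProduct, sum_eq_sum_subtype_of_vanish' p]
    · refine Finset.sum_congr rfl fun a _ => ?_
      rw [sectorExtend_val]; rfl
    · intro j hj; rw [sectorExtend_of_not p hj, mul_zero]
  · rw [sectorExtend_of_not p hi]
    refine Finset.sum_eq_zero fun j _ => ?_
    by_cases hj : p j
    · rw [hinv i j hi hj, zero_mul]
    · rw [sectorExtend_of_not p hj, mul_zero]

/-- The Rayleigh-type quotient of a sector-preserving `X` in an extended sector eigenvector is the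
diagonal entry of the rotated compression: `⟨ψ_a, X ψ_a⟩ = (V⋆ X|_p V)_{aa}`. [folklore] -/
private theorem star_sectorEigenvector_dotProduct_mulVec {A X : Matrix ι ι ℂ} (hA : A.IsHermitian)
    (hX : ∀ i j, ¬ p i → p j → X i j = 0) (a : Subtype p) :
    star (sectorEigenvector p A hA a) ⬝ᵥ (X *ᵥ sectorEigenvector p A hA a) =
      (star ((hA.submatrix (Subtype.val : Subtype p → ι)).eigenvectorUnitary :
          Matrix (Subtype p) (Subtype p) ℂ) *
        X.submatrix (Subtype.val : Subtype p → ι) Subtype.val *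
        ((hA.submatrix (Subtype.val : Subtype p → ι)).eigenvectorUnitary :
          Matrix (Subtype p) (Subtype p) ℂ) : Matrix (Subtype p) (Subtype p) ℂ) a a := by
  classical
  rw [sectorEigenvector, mulVec_sectorExtend' p hX, star_sectorExtend_dotProduct']
  simp only [sectorExtend_val]
  rw [Matrix.mul_assoc, Matrix.mul_apply, dotProduct]
  refine Finset.sum_congr rfl fun b _ => ?_
  rw [Pi.star_apply, Matrix.star_apply, Matrix.mul_apply, mulVec, dotProduct]

/-- **Mixture form of the Gibbs expectation of a sector-preserving observable.** For a Hermitian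
`A` and any `X` on a finite index type, both without entries from the complement of a coordinate
sector `p` into `p`, the Gibbs expectation of the compression `X|_p` in the Gibbs state of the
compression `A|_p` is the canonical mixture of the expectations of `X` in the extended sector
eigenvectors of `A`:
`Re ⟨X|_p⟩_{β, A|_p} = Σ_a w_a(β) · Re⟨ψ_a, X ψ_a⟩`, `w_a = e^{-βE_a}/Σ_b e^{-βE_b}`.
[cite: Israel1979, Lemma II.3.1] -/
theorem re_gibbsState_submatrix_eq_sum_canonicalWeight {A X : Matrix ι ι ℂ} (hA : A.IsHermitian)
    (hX : ∀ i j, ¬ p i → p j → X i j = 0) (β : ℝ) :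
    (gibbsState β (A.submatrix (Subtype.val : Subtype p → ι) Subtype.val)
        (X.submatrix (Subtype.val : Subtype p → ι) Subtype.val)).re =
      ∑ a : Subtype p, canonicalWeight β (sectorEigenvalue p A hA) a *
        (star (sectorEigenvector p A hA a) ⬝ᵥ (X *ᵥ sectorEigenvector p A hA a)).re := by
  classical
  rw [(hA.submatrix (Subtype.val : Subtype p → ι)).re_gibbsState β,
    (hA.submatrix (Subtype.val : Subtype p → ι)).gibbsWeight_eq β, trace_unitary_conj_mul]
  simp only [trace, diag_apply, diagonal_mul, Complex.re_sum, Complex.re_ofReal_mul, Finset.mul_sum]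
  refine Finset.sum_congr rfl fun a _ => ?_
  rw [star_sectorEigenvector_dotProduct_mulVec p hA hX a, canonicalWeight]
  simp only [sectorEigenvalue]
  ring

end General

/-! ### §2 The canonical sector of the `t–t'` torus: affinity in `t'`, the thermal diagonal-hopping
energy is antitone in `t'`, Peierls–Bogoliubov bracket on the free-energy increments -/

section Sector

variable {n : ℝ}

/-- The Peierls–Bogoliubov bracket `β Re⟨W⟩_{H+W} ≤ log Z(H) − log Z(H+W) ≤ β Re⟨W⟩_H` (the tree's
`log_partitionFn_sub_le_log_partitionFn_add` read at `H` and at `H + W`; also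
`GibbsFreeEnergyCouplingConcavity.log_partitionFn_sub_mem_Icc`). [cite: Lieb1973, §V (5.2)–(5.4)] -/
private theorem pb_bracket {m : Type*} [Fintype m] [DecidableEq m] [Nonempty m] {H W : Matrix m m ℂ}
    (hH : H.IsHermitian) (hW : W.IsHermitian) (β : ℝ) :
    β * (gibbsState β (H + W) W).re ≤
        Real.log (partitionFn β H).re - Real.log (partitionFn β (H + W)).re ∧
      Real.log (partitionFn β H).re - Real.log (partitionFn β (H + W)).re ≤
        β * (gibbsState β H W).re := by
  have h1 := log_partitionFn_sub_le_log_partitionFn_add hH hW β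
  have h2 := log_partitionFn_sub_le_log_partitionFn_add (hH.add hW) hW.neg β
  rw [add_neg_cancel_right, map_neg, Complex.neg_re] at h2
  constructor <;> linarith

/-- A real multiple of a Hermitian matrix is Hermitian. [folklore] -/
private theorem isHermitian_ofReal_smul_sectorTT {m : Type*} {K : Matrix m m ℂ} (hK : K.IsHermitian) (c : ℝ) :
    ((c : ℂ) • K).IsHermitian := by
  rw [Matrix.IsHermitian, Matrix.conjTranspose_smul, hK.eq, Complex.star_def, Complex.conj_ofReal]

/-- **The `t'`-term enters the sector Hamiltonian linearly**:
`H_L(t,s₂,U)|_sec = H_L(t,s₁,U)|_sec + (s₂ − s₁) · H_L(0,1,0)|_sec`. [cite: XuEtAl2024, eq. (1)] -/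
theorem sectorHamiltonianTT'_eq_add_smul_tPrime (L : ℕ) [NeZero L] (t s₁ s₂ U n : ℝ) :
    sectorHamiltonianTT' t s₂ U n L =
      sectorHamiltonianTT' t s₁ U n L + ((s₂ - s₁ : ℝ) : ℂ) • sectorHamiltonianTT' 0 1 0 n L := by
  unfold sectorHamiltonianTT'
  rw [TTPrimeFree.hubbardTorusTT'_eq_add_smul_diagHop t s₁ U s₂, TTPrimeFree.hubbardTorusTT'_tzero_Uzero]
  ext a b
  simp only [submatrix_apply, Matrix.add_apply, Matrix.smul_apply, smul_eq_mul]
  push_cast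
  ring

/-- **Mixture form of the sector Gibbs expectation at another coupling**:
`Re⟨H_L(t₂,s₂,U₂)|_sec⟩_{β, H_L(t,s,U)|_sec} = Σ_i p_{L,i}(β) Re⟨ψ_{L,i}, H_L(t₂,s₂,U₂) ψ_{L,i}⟩`,
the `ψ_{L,i}` being the sector eigenbasis of `H_L(t,s,U)` and `p_{L,i}` its canonical weights
(generalises `re_gibbsState_sectorHamiltonianTT'`, the case `(t₂,s₂,U₂) = (t,s,U)`).
[cite: Israel1979, Lemma II.3.1] -/
theorem re_gibbsState_sectorHamiltonianTT'_coupling (β t t' U n : ℝ) (L : ℕ) (t₂ t₂' U₂ : ℝ) :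
    (gibbsState β (sectorHamiltonianTT' t t' U n L) (sectorHamiltonianTT' t₂ t₂' U₂ n L)).re =
      ∑ i, sectorGibbsWeightTT' β t t' U n L i *
        (expect (hubbardTorusTT' L t₂ t₂' U₂) (sectorGibbsVectorTT' t t' U n L i)).re := by
  have h := re_gibbsState_submatrix_eq_sum_canonicalWeight (szConfig n L)
    (hubbardTorusTT'_isHermitian L t t' U)
    (fun s s' hs hs' => hubbardTorusTT'_apply_eq_zero_of_szConfig L t₂ t₂' U₂ n s s' hs hs') β
  rw [sectorHamiltonianTT', sectorHamiltonianTT', h,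
    ← Equiv.sum_comp (sectorGibbsIndex n L)]
  refine Finset.sum_congr rfl fun i _ => ?_
  have hw : sectorGibbsWeightTT' β t t' U n L i =
      canonicalWeight β (sectorEigenvalue (szConfig n L) (hubbardTorusTT' L t t' U)
        (hubbardTorusTT'_isHermitian L t t' U)) (sectorGibbsIndex n L i) := by
    unfold sectorGibbsWeightTT' canonicalWeight sectorGibbsEnergyTT'
    rw [← Equiv.sum_comp (sectorGibbsIndex n L)]
  rw [hw]
  rfl

/-- **The thermal diagonal-hopping energy of the canonical sector Gibbs state is antitone in `t'`**
(finite volume, `β > 0`): for `s₁ ≤ s₂`,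
`Σ_i p_{L,i}(s₂) Re⟨ψ_{L,i}(s₂), H_L(0,1,0) ψ_{L,i}(s₂)⟩ ≤ Σ_i p_{L,i}(s₁) Re⟨ψ_{L,i}(s₁), H_L(0,1,0) ψ_{L,i}(s₁)⟩`
— the two Peierls–Bogoliubov tangents of the concave free energy `s ↦ −β⁻¹ log Z_{L,β}(t,s,U)`
(Peierls–Bogoliubov both ways). [cite: Lieb1973, §V (5.2)–(5.4)] [cite: Ruelle1969, §2.5] -/
theorem sectorGibbs_diagHopMean_anti_tPrime (hn0 : 0 ≤ n) (hn2 : n ≤ 2) (L : ℕ) [NeZero L]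
    (t U : ℝ) {β : ℝ} (hβ : 0 < β) {s₁ s₂ : ℝ} (hs : s₁ ≤ s₂) :
    ∑ i, sectorGibbsWeightTT' β t s₂ U n L i *
        (expect (hubbardTorusTT' L 0 1 0) (sectorGibbsVectorTT' t s₂ U n L i)).re ≤
      ∑ i, sectorGibbsWeightTT' β t s₁ U n L i *
        (expect (hubbardTorusTT' L 0 1 0) (sectorGibbsVectorTT' t s₁ U n L i)).re := by
  haveI := nonempty_szConfig hn0 hn2 L
  rcases hs.eq_or_lt with h | hlt
  · subst h; exact le_rfl
  have hd : 0 < s₂ - s₁ := sub_pos.2 hlt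
  set H := sectorHamiltonianTT' t s₁ U n L with hH
  set K := sectorHamiltonianTT' 0 1 0 n L with hK
  set W := ((s₂ - s₁ : ℝ) : ℂ) • K with hW
  have hHh : H.IsHermitian := isHermitian_sectorHamiltonianTT' t s₁ U n L
  have hKh : K.IsHermitian := isHermitian_sectorHamiltonianTT' 0 1 0 n L
  have hWh : W.IsHermitian := by
    rw [hW]; exact isHermitian_ofReal_smul_sectorTT hKh _
  have hHW : sectorHamiltonianTT' t s₂ U n L = H + W := by
    rw [hH, hW, hK]; exact sectorHamiltonianTT'_eq_add_smul_tPrime L t s₁ s₂ U n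
  have hb := pb_bracket hHh hWh β
  have hle : β * (gibbsState β (H + W) W).re ≤ β * (gibbsState β H W).re := hb.1.trans hb.2
  have hle' : (gibbsState β (H + W) W).re ≤ (gibbsState β H W).re := le_of_mul_le_mul_left hle hβ
  have hlin : ∀ G : Matrix _ _ ℂ, (gibbsState β G W).re = (s₂ - s₁) * (gibbsState β G K).re := by
    intro G
    rw [hW, map_smul, smul_eq_mul, Complex.re_ofReal_mul]
  rw [hlin, hlin, ← hHW] at hle'
  have hle'' := le_of_mul_le_mul_left hle' hd
  rwa [hK, hH, re_gibbsState_sectorHamiltonianTT'_coupling,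
    re_gibbsState_sectorHamiltonianTT'_coupling] at hle''

/-- **Peierls–Bogoliubov bracket on the sector free-energy increment along `t'`** (finite volume,
every real `β`): with `Z_L(s) = Z_β(H_L(t,s,U)|_sec)`,
`β(s₂−s₁)·Σ_i p_{L,i}(s₂)Re⟨ψ_{L,i}(s₂), H_L(0,1,0)ψ_{L,i}(s₂)⟩ ≤ log Z_L(s₁) − log Z_L(s₂)
  ≤ β(s₂−s₁)·Σ_i p_{L,i}(s₁)Re⟨ψ_{L,i}(s₁), H_L(0,1,0)ψ_{L,i}(s₁)⟩` — the `T > 0` twin of the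
two-sided energy-increment bracket `B(s₂−s₁) ≤ e(s₂) − e(s₁) ≤ A(s₂−s₁)`.
[cite: Lieb1973, §V (5.2)–(5.4)] -/
theorem log_partitionFn_sector_sub_mem_Icc_tPrime (hn0 : 0 ≤ n) (hn2 : n ≤ 2) (L : ℕ) [NeZero L]
    (t U β s₁ s₂ : ℝ) :
    Real.log (partitionFn β (sectorHamiltonianTT' t s₁ U n L)).re -
        Real.log (partitionFn β (sectorHamiltonianTT' t s₂ U n L)).re ∈
      Set.Icc
        (β * ((s₂ - s₁) * ∑ i, sectorGibbsWeightTT' β t s₂ U n L i *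
          (expect (hubbardTorusTT' L 0 1 0) (sectorGibbsVectorTT' t s₂ U n L i)).re))
        (β * ((s₂ - s₁) * ∑ i, sectorGibbsWeightTT' β t s₁ U n L i *
          (expect (hubbardTorusTT' L 0 1 0) (sectorGibbsVectorTT' t s₁ U n L i)).re)) := by
  haveI := nonempty_szConfig hn0 hn2 L
  set H := sectorHamiltonianTT' t s₁ U n L with hH
  set K := sectorHamiltonianTT' 0 1 0 n L with hK
  set W := ((s₂ - s₁ : ℝ) : ℂ) • K with hW
  have hHh : H.IsHermitian := isHermitian_sectorHamiltonianTT' t s₁ U n L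
  have hKh : K.IsHermitian := isHermitian_sectorHamiltonianTT' 0 1 0 n L
  have hWh : W.IsHermitian := by
    rw [hW]; exact isHermitian_ofReal_smul_sectorTT hKh _
  have hHW : sectorHamiltonianTT' t s₂ U n L = H + W := by
    rw [hH, hW, hK]; exact sectorHamiltonianTT'_eq_add_smul_tPrime L t s₁ s₂ U n
  have hb := pb_bracket hHh hWh β
  have hlin : ∀ G : Matrix _ _ ℂ, (gibbsState β G W).re = (s₂ - s₁) * (gibbsState β G K).re := by
    intro G
    rw [hW, map_smul, smul_eq_mul, Complex.re_ofReal_mul]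
  rw [hlin, hlin, ← hHW, hK, hH, re_gibbsState_sectorHamiltonianTT'_coupling, ← hH, hHW,
    re_gibbsState_sectorHamiltonianTT'_coupling] at hb
  rw [hHW]
  exact hb

end Sector

/-! ### §3 Thermodynamic limit along common tori: the thermal `K₂` is antitone in `t'` -/

namespace InfVolFermionState

variable {t U n β : ℝ}

/-- **The thermal diagonal-hopping energy per site is antitone in `t'` along a common sequence of
tori.** If `ω₁`, `ω₂` are torus limits of the canonical sector Gibbs states of `H(t,s₁,U)`,
`H(t,s₂,U)` at the same `β > 0` and density along the SAME `Ls → ∞`, and `s₁ ≤ s₂`, then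
`K₂(ω₂) ≤ K₂(ω₁)` (`K₂(ω) = e_{Φ(0,1,0)}(ω)`): the finite-volume antitonicity
`sectorGibbs_diagHopMean_anti_tPrime` divided by `L²` and the two limits
(`IsTorusLimitOfMixture.tendsto_meanEnergy_hubbardTTPrime 0 1 0`). The `T > 0` twin of
`IsTorusLimitOf.diagHopEnergy_anti_of_groundStates`. [cite: Ruelle1969, §2.5] [cite: Lieb1973, §V (5.2)–(5.4)] -/
theorem IsTorusLimitOfMixture.meanEnergy_diagHop_anti_of_sectorGibbs
    (hn0 : 0 ≤ n) (hn2 : n ≤ 2) (hβ : 0 < β) {s₁ s₂ : ℝ} (hs : s₁ ≤ s₂)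
    {ω₁ ω₂ : InfVolFermionState 2} {Ls : ℕ → ℕ}
    (h₁ : ω₁.IsTorusLimitOfMixture (sectorGibbsCount n) (fun L => sectorGibbsWeightTT' β t s₁ U n L)
      (fun L => sectorGibbsVectorTT' t s₁ U n L) Ls)
    (h₂ : ω₂.IsTorusLimitOfMixture (sectorGibbsCount n) (fun L => sectorGibbsWeightTT' β t s₂ U n L)
      (fun L => sectorGibbsVectorTT' t s₂ U n L) Ls)
    (hLs : Tendsto Ls atTop atTop) :
    ω₂.meanEnergy (hubbardTTPrimeFermionInteraction 0 1 0) 1 ≤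
      ω₁.meanEnergy (hubbardTTPrimeFermionInteraction 0 1 0) 1 := by
  refine le_of_tendsto_of_tendsto (h₂.tendsto_meanEnergy_hubbardTTPrime 0 1 0 hLs)
    (h₁.tendsto_meanEnergy_hubbardTTPrime 0 1 0 hLs) ?_
  filter_upwards [hLs.eventually_ge_atTop 1] with j hj
  haveI : NeZero (Ls j) := ⟨by omega⟩
  have hL2 : (0 : ℝ) < (Ls j : ℝ) ^ 2 := by positivity
  have hmono := sectorGibbs_diagHopMean_anti_tPrime hn0 hn2 (Ls j) t U hβ hs
  have hsum : ∀ (b : ℝ), ∑ i, sectorGibbsWeightTT' β t b U n (Ls j) i *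
      ((QuantumLattice.expect (hubbardTorusTT' (Ls j) 0 1 0) (sectorGibbsVectorTT' t b U n (Ls j) i)).re /
        (Ls j : ℝ) ^ 2) =
      (∑ i, sectorGibbsWeightTT' β t b U n (Ls j) i *
        (QuantumLattice.expect (hubbardTorusTT' (Ls j) 0 1 0) (sectorGibbsVectorTT' t b U n (Ls j) i)).re) /
        (Ls j : ℝ) ^ 2 := by
    intro b
    rw [Finset.sum_div]
    exact Finset.sum_congr rfl fun i _ => by ring
  simp only [hsum]
  exact div_le_div_of_nonneg_right hmono hL2.le

end InfVolFermionState

/-! ### §4 Existence of torus-limit thermal states of the `t–t'` Hubbard model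
(compactness for mixtures, `TorusLimitOfMixturesCompactness`) -/

section Compactness

/-- **Torus-limit thermal states of the `t–t'` Hubbard model exist** at every coupling, density
`0 ≤ n ≤ 2` and inverse temperature `β`: along every `Ls → ∞` there are a subsequence and an
infinite-volume state which is the torus limit of the canonical sector Gibbs states
`ρ_{L,β} = e^{-βH_L(t,t',U)|_sec}/Z` (so the «for every thermal torus limit» rows of
`TorusSectorGibbsMixture` / `TorusSectorGibbsEnergyWindow` and of this file are never vacuous).
[cite: BratteliRobinsonI1987, Thm. 2.3.15 (weak-⋆ compactness of the state space) and §4.3.1] [cite: Israel1979, §I.3 eq. (26)] -/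
theorem exists_isTorusLimitOfMixture_sectorGibbs (β t t' U : ℝ) {n : ℝ} (hn0 : 0 ≤ n) (hn2 : n ≤ 2)
    {Ls : ℕ → ℕ} (hLs : Tendsto Ls atTop atTop) :
    ∃ φ : ℕ → ℕ, StrictMono φ ∧ ∃ ω : InfVolFermionState 2,
      ω.IsTorusLimitOfMixture (sectorGibbsCount n) (fun L => sectorGibbsWeightTT' β t t' U n L)
        (fun L => sectorGibbsVectorTT' t t' U n L) (Ls ∘ φ) :=
  InfVolFermionState.exists_isTorusLimitOfMixture_subseq _ _ hLs
    (fun j i => sectorGibbsWeightTT'_nonneg β t t' U n (Ls j) i)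
    (fun j => sum_sectorGibbsWeightTT' β t t' U hn0 hn2 (Ls j))
    (fun j i => star_sectorGibbsVectorTT'_dotProduct_self t t' U n (Ls j) i)

end Compactness

/-! ### §5 BOX ⇒ WORD at `T > 0`: endpoint words bracket the thermal `K₂` on the whole `t'`-box -/

namespace InfVolFermionState

variable {t U n β : ℝ}

/-- **A thermal `K₂`-ceiling word moves to the right.** If `K₂(ω₁) ≤ A` for EVERY torus limit `ω₁`
(along any `Ls₁ → ∞`) of the canonical sector Gibbs states of `H(t,s₁,U)` at `(β, n)` (`β > 0`,
`0 ≤ n ≤ 2`), then `K₂(ω) ≤ A` for every torus limit `ω` of the canonical sector Gibbs states of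
`H(t,s,U)` at the same `(β, n)`, for every `s ≥ s₁`. Proof: extract along `ω`'s tori a torus limit
`ω₁` at `s₁` (`exists_isTorusLimitOfMixture_sectorGibbs`), pass `ω` to the same subsequence and
compare (`meanEnergy_diagHop_anti_of_sectorGibbs`). The `T > 0` twin of
`IsTorusLimitOf.meanEnergy_diagHop_le_of_forall_left`. [cite: Ruelle1969, §2.5] [cite: Lieb1973, §V (5.2)–(5.4)] -/
theorem IsTorusLimitOfMixture.meanEnergy_diagHop_le_of_forall_left_of_sectorGibbs
    (hn0 : 0 ≤ n) (hn2 : n ≤ 2) (hβ : 0 < β) {s₁ s : ℝ} (hs : s₁ ≤ s) {A : ℝ}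
    (hA : ∀ (ω₁ : InfVolFermionState 2) (Ls₁ : ℕ → ℕ), Tendsto Ls₁ atTop atTop →
      ω₁.IsTorusLimitOfMixture (sectorGibbsCount n) (fun L => sectorGibbsWeightTT' β t s₁ U n L)
        (fun L => sectorGibbsVectorTT' t s₁ U n L) Ls₁ →
      ω₁.meanEnergy (hubbardTTPrimeFermionInteraction 0 1 0) 1 ≤ A)
    {ω : InfVolFermionState 2} {Ls : ℕ → ℕ}
    (h : ω.IsTorusLimitOfMixture (sectorGibbsCount n) (fun L => sectorGibbsWeightTT' β t s U n L)
      (fun L => sectorGibbsVectorTT' t s U n L) Ls)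
    (hLs : Tendsto Ls atTop atTop) :
    ω.meanEnergy (hubbardTTPrimeFermionInteraction 0 1 0) 1 ≤ A := by
  obtain ⟨φ, hφ, ω₁, h₁⟩ := exists_isTorusLimitOfMixture_sectorGibbs β t s₁ U hn0 hn2 hLs
  have hLφ : Tendsto (Ls ∘ φ) atTop atTop := hLs.comp hφ.tendsto_atTop
  exact (h₁.meanEnergy_diagHop_anti_of_sectorGibbs hn0 hn2 hβ hs (h.comp_tendsto hφ.tendsto_atTop)
    hLφ).trans (hA ω₁ (Ls ∘ φ) hLφ h₁)

/-- **A thermal `K₂`-floor word moves to the left**: if `B ≤ K₂(ω₂)` for every torus limit of the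
canonical sector Gibbs states of `H(t,s₂,U)` at `(β, n)`, then `B ≤ K₂(ω)` for every torus limit of
the canonical sector Gibbs states of `H(t,s,U)` at `(β, n)`, `s ≤ s₂`. The `T > 0` twin of
`IsTorusLimitOf.le_meanEnergy_diagHop_of_forall_right`. [cite: Ruelle1969, §2.5] [cite: Lieb1973, §V (5.2)–(5.4)] -/
theorem IsTorusLimitOfMixture.le_meanEnergy_diagHop_of_forall_right_of_sectorGibbs
    (hn0 : 0 ≤ n) (hn2 : n ≤ 2) (hβ : 0 < β) {s s₂ : ℝ} (hs : s ≤ s₂) {B : ℝ}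
    (hB : ∀ (ω₂ : InfVolFermionState 2) (Ls₂ : ℕ → ℕ), Tendsto Ls₂ atTop atTop →
      ω₂.IsTorusLimitOfMixture (sectorGibbsCount n) (fun L => sectorGibbsWeightTT' β t s₂ U n L)
        (fun L => sectorGibbsVectorTT' t s₂ U n L) Ls₂ →
      B ≤ ω₂.meanEnergy (hubbardTTPrimeFermionInteraction 0 1 0) 1)
    {ω : InfVolFermionState 2} {Ls : ℕ → ℕ}
    (h : ω.IsTorusLimitOfMixture (sectorGibbsCount n) (fun L => sectorGibbsWeightTT' β t s U n L)
      (fun L => sectorGibbsVectorTT' t s U n L) Ls)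
    (hLs : Tendsto Ls atTop atTop) :
    B ≤ ω.meanEnergy (hubbardTTPrimeFermionInteraction 0 1 0) 1 := by
  obtain ⟨φ, hφ, ω₂, h₂⟩ := exists_isTorusLimitOfMixture_sectorGibbs β t s₂ U hn0 hn2 hLs
  have hLφ : Tendsto (Ls ∘ φ) atTop atTop := hLs.comp hφ.tendsto_atTop
  exact (hB ω₂ (Ls ∘ φ) hLφ h₂).trans
    ((h.comp_tendsto hφ.tendsto_atTop).meanEnergy_diagHop_anti_of_sectorGibbs hn0 hn2 hβ hs h₂ hLφ)

/-- **The two ENDPOINT words bracket the thermal `K₂` on the whole box**: a ceiling word `A` for the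
thermal torus limits at `s₁` and a floor word `B` for those at `s₂` give `B ≤ K₂(ω) ≤ A` for every
torus limit of the canonical sector Gibbs states at every `s ∈ [s₁, s₂]` (same `β > 0`, `t`, `U`, `n`).
The `T > 0` twin of `IsTorusLimitOf.meanEnergy_diagHop_mem_Icc_of_forall_endpoints`.
[cite: Ruelle1969, §2.5] [cite: Lieb1973, §V (5.2)–(5.4)] -/
theorem IsTorusLimitOfMixture.meanEnergy_diagHop_mem_Icc_of_forall_endpoints_of_sectorGibbs
    (hn0 : 0 ≤ n) (hn2 : n ≤ 2) (hβ : 0 < β) {s₁ s₂ s : ℝ} (hs : s ∈ Set.Icc s₁ s₂) {A B : ℝ}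
    (hA : ∀ (ω₁ : InfVolFermionState 2) (Ls₁ : ℕ → ℕ), Tendsto Ls₁ atTop atTop →
      ω₁.IsTorusLimitOfMixture (sectorGibbsCount n) (fun L => sectorGibbsWeightTT' β t s₁ U n L)
        (fun L => sectorGibbsVectorTT' t s₁ U n L) Ls₁ →
      ω₁.meanEnergy (hubbardTTPrimeFermionInteraction 0 1 0) 1 ≤ A)
    (hB : ∀ (ω₂ : InfVolFermionState 2) (Ls₂ : ℕ → ℕ), Tendsto Ls₂ atTop atTop →
      ω₂.IsTorusLimitOfMixture (sectorGibbsCount n) (fun L => sectorGibbsWeightTT' β t s₂ U n L)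
        (fun L => sectorGibbsVectorTT' t s₂ U n L) Ls₂ →
      B ≤ ω₂.meanEnergy (hubbardTTPrimeFermionInteraction 0 1 0) 1)
    {ω : InfVolFermionState 2} {Ls : ℕ → ℕ}
    (h : ω.IsTorusLimitOfMixture (sectorGibbsCount n) (fun L => sectorGibbsWeightTT' β t s U n L)
      (fun L => sectorGibbsVectorTT' t s U n L) Ls)
    (hLs : Tendsto Ls atTop atTop) :
    ω.meanEnergy (hubbardTTPrimeFermionInteraction 0 1 0) 1 ∈ Set.Icc B A :=
  ⟨h.le_meanEnergy_diagHop_of_forall_right_of_sectorGibbs hn0 hn2 hβ hs.2 hB hLs,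
    h.meanEnergy_diagHop_le_of_forall_left_of_sectorGibbs hn0 hn2 hβ hs.1 hA hLs⟩

end InfVolFermionState



/-! ### §6 Thermal CAP TRANSPORT: the anchor window of a thermal torus limit anywhere in the box,
and BOX ⇒ WORD on the `(t'-box) × (T ≤ T₀)` cell from ONE anchor certificate -/

namespace InfVolFermionState

variable {t U n β : ℝ}

/-- **Thermal anchor cap, two-state form.** Let `ω` be a torus limit of the canonical sector Gibbs
states of `H(t,s,U)` at `(β, n)` (`β > 0`, `U ≥ 0`, `0 ≤ n < 2`) and `ω₀` a torus-limit ground state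
at the ANCHOR `s₀`. Then, for the anchor Hamiltonian,
`e_{Φ(t,s₀,U)}(ω) ≤ e(t,s₀,U,n) + 2H_b(n/2)/β + (s − s₀)·(K₂(ω₀) − K₂(ω))`:
affinity `e_{Φ(t,s₀,U)}(ω) = e_{Φ(t,s,U)}(ω) + (s₀ − s)K₂(ω)`, the entropy cap at `s`
(`…le_energyDensityTT'_add_binEntropy_div`) and the supergradient inequality at the anchor
(`IsTorusLimitOf.energyDensityTT'_le_affine`). The `T > 0` twin of
`IsTorusLimitOf.meanEnergy_anchor_le_of_groundStates` (the extra term is the entropy price `T·s_max(n)`).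
[cite: Israel1979, Lemma II.3.1] [cite: Ruelle1969, §3.4] -/
theorem IsTorusLimitOfMixture.meanEnergy_anchor_le_of_groundState_of_sectorGibbs (t s₀ s : ℝ)
    {U : ℝ} (hU : 0 ≤ U) {n : ℝ} (hn0 : 0 ≤ n) (hn2 : n < 2) {β : ℝ} (hβ : 0 < β)
    {ω : InfVolFermionState 2} {Ls : ℕ → ℕ}
    (h : ω.IsTorusLimitOfMixture (sectorGibbsCount n) (fun L => sectorGibbsWeightTT' β t s U n L)
      (fun L => sectorGibbsVectorTT' t s U n L) Ls) (hLs : Tendsto Ls atTop atTop)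
    {ω₀ : InfVolFermionState 2} {ψ₀ : ∀ L, Fock (Orb (FermionTorus 2 L))} {Ls₀ : ℕ → ℕ}
    (h₀ : ω₀.IsTorusLimitOf ψ₀ Ls₀) (hLs₀ : Tendsto Ls₀ atTop atTop)
    (hψ₀ : ∀ j, IsGroundStateInSector (hubbardTorusTT' (Ls₀ j) t s₀ U) (rectN n (Ls₀ j)) 0 (ψ₀ (Ls₀ j)))
    (h1₀ : ∀ j, star (ψ₀ (Ls₀ j)) ⬝ᵥ ψ₀ (Ls₀ j) = 1) :
    ω.meanEnergy (hubbardTTPrimeFermionInteraction t s₀ U) 1 ≤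
      energyDensityTT' t s₀ U n + 2 * Real.binEntropy (n / 2) / β +
        (s - s₀) * (ω₀.meanEnergy (hubbardTTPrimeFermionInteraction 0 1 0) 1 -
          ω.meanEnergy (hubbardTTPrimeFermionInteraction 0 1 0) 1) := by
  have haff := ω.meanEnergy_hubbardTTPrime_affine t s U s₀ U
  have hcap := h.meanEnergy_hubbardTTPrime_le_energyDensityTT'_add_binEntropy_div t s hU hn0 hn2 hβ hLs
  have hsg := h₀.energyDensityTT'_le_affine t s₀ hU hn0 hn2 hLs₀ hψ₀ h1₀ s hU
  rw [sub_self, zero_mul, add_zero] at haff hsg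
  rw [haff, mul_sub]
  have key : (s₀ - s) * ω.meanEnergy (hubbardTTPrimeFermionInteraction 0 1 0) 1 =
      -((s - s₀) * ω.meanEnergy (hubbardTTPrimeFermionInteraction 0 1 0) 1) := by ring
  rw [key]
  linarith

/-- **Thermal anchor WINDOW, kinematic form** (no words needed): every torus limit `ω` of the
canonical sector Gibbs states of `H(t,s,U)` at `(β, n)` satisfies, for EVERY anchor `s₀`,
`e(t,s₀,U,n) ≤ e_{Φ(t,s₀,U)}(ω) ≤ e(t,s₀,U,n) + 2H_b(n/2)/β + (32/π²)|s − s₀|`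
(cut row at the anchor coupling; entropy cap at `s`; `|e(s) − e(s₀)| ≤ (16/π²)|s − s₀|`
(`energyDensityTT'_le_of_upperBound_tPrime_kinematic`) and `|K₂(ω)| ≤ 16/π²`). The `T > 0` twin of
`IsTorusLimitOf.meanEnergy_anchor_mem_Icc_kinematic`. [cite: Israel1979, Lemma II.3.1] [cite: LiebLoss1993, §8, Theorem 8.2] -/
theorem IsTorusLimitOfMixture.meanEnergy_anchor_mem_Icc_kinematic_of_sectorGibbs (t s₀ s : ℝ)
    {U : ℝ} (hU : 0 ≤ U) {n : ℝ} (hn0 : 0 ≤ n) (hn2 : n < 2) {β : ℝ} (hβ : 0 < β)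
    {ω : InfVolFermionState 2} {Ls : ℕ → ℕ}
    (h : ω.IsTorusLimitOfMixture (sectorGibbsCount n) (fun L => sectorGibbsWeightTT' β t s U n L)
      (fun L => sectorGibbsVectorTT' t s U n L) Ls) (hLs : Tendsto Ls atTop atTop) :
    ω.meanEnergy (hubbardTTPrimeFermionInteraction t s₀ U) 1 ∈
      Set.Icc (energyDensityTT' t s₀ U n)
        (energyDensityTT' t s₀ U n + 2 * Real.binEntropy (n / 2) / β + 32 / Real.pi ^ 2 * |s - s₀|) := by
  refine ⟨h.energyDensityTT'_le_meanEnergy_of_sectorGibbs t s U hn0 hn2 β hLs s₀ hU, ?_⟩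
  have haff := ω.meanEnergy_hubbardTTPrime_affine t s U s₀ U
  have hcap := h.meanEnergy_hubbardTTPrime_le_energyDensityTT'_add_binEntropy_div t s hU hn0 hn2 hβ hLs
  have hkin := energyDensityTT'_le_of_upperBound_tPrime_kinematic t hU hn0 hn2 (s := s₀) (s' := s)
    (le_refl (energyDensityTT' t s₀ U n))
  have hK := h.abs_meanEnergy_diagHop_le_of_sectorGibbs t s U hn0 hn2 β hLs
  rw [sub_self, zero_mul, add_zero] at haff
  have h3 : (s₀ - s) * ω.meanEnergy (hubbardTTPrimeFermionInteraction 0 1 0) 1 ≤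
      16 / Real.pi ^ 2 * |s - s₀| :=
    calc (s₀ - s) * ω.meanEnergy (hubbardTTPrimeFermionInteraction 0 1 0) 1
        ≤ |(s₀ - s) * ω.meanEnergy (hubbardTTPrimeFermionInteraction 0 1 0) 1| := le_abs_self _
      _ = |s - s₀| * |ω.meanEnergy (hubbardTTPrimeFermionInteraction 0 1 0) 1| := by
          rw [abs_mul, abs_sub_comm]
      _ ≤ |s - s₀| * (16 / Real.pi ^ 2) := mul_le_mul_of_nonneg_left hK (abs_nonneg _)
      _ = 16 / Real.pi ^ 2 * |s - s₀| := mul_comm _ _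
  have hc : (32 : ℝ) / Real.pi ^ 2 * |s - s₀| = 16 / Real.pi ^ 2 * |s - s₀| + 16 / Real.pi ^ 2 * |s - s₀| := by
    ring
  rw [haff, hc]
  linarith

/-- **Thermal anchor cap from WORDS, right of the anchor** (`s₀ ≤ s ≤ s₂`): a cap `e(t,s₀,U,n) ≤ u₀`,
a ground-state `K₂`-CEILING word `A₀` at the anchor and a THERMAL `K₂`-FLOOR word `B₂` at `(β, s₂)`
give `e_{Φ(t,s₀,U)}(ω) ≤ u₀ + 2H_b(n/2)/β + (s − s₀)(A₀ − B₂)` for every torus limit of the canonical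
sector Gibbs states of `H(t,s,U)` at `(β, n)` (two-state form + existence of a torus-limit ground
state at the anchor + `le_meanEnergy_diagHop_of_forall_right_of_sectorGibbs`).
[cite: Israel1979, Lemma II.3.1] [cite: Lieb1973, §V (5.2)–(5.4)] -/
theorem IsTorusLimitOfMixture.meanEnergy_anchor_le_of_words_right_of_sectorGibbs (t : ℝ)
    {s₀ s s₂ : ℝ} (h0s : s₀ ≤ s) (hs₂ : s ≤ s₂)
    {U : ℝ} (hU : 0 ≤ U) {n : ℝ} (hn0 : 0 ≤ n) (hn2 : n < 2) {β : ℝ} (hβ : 0 < β) {u₀ A₀ B₂ : ℝ}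
    (hu₀ : energyDensityTT' t s₀ U n ≤ u₀)
    (hA₀ : ∀ (ω₀ : InfVolFermionState 2) (Ls₀ : ℕ → ℕ) (ψ₀ : ∀ L, Fock (Orb (FermionTorus 2 L))),
      Tendsto Ls₀ atTop atTop →
      (∀ j, IsGroundStateInSector (hubbardTorusTT' (Ls₀ j) t s₀ U) (rectN n (Ls₀ j)) 0 (ψ₀ (Ls₀ j))) →
      (∀ j, star (ψ₀ (Ls₀ j)) ⬝ᵥ ψ₀ (Ls₀ j) = 1) → ω₀.IsTorusLimitOf ψ₀ Ls₀ →
      ω₀.meanEnergy (hubbardTTPrimeFermionInteraction 0 1 0) 1 ≤ A₀)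
    (hB₂ : ∀ (ω₂ : InfVolFermionState 2) (Ls₂ : ℕ → ℕ), Tendsto Ls₂ atTop atTop →
      ω₂.IsTorusLimitOfMixture (sectorGibbsCount n) (fun L => sectorGibbsWeightTT' β t s₂ U n L)
        (fun L => sectorGibbsVectorTT' t s₂ U n L) Ls₂ →
      B₂ ≤ ω₂.meanEnergy (hubbardTTPrimeFermionInteraction 0 1 0) 1)
    {ω : InfVolFermionState 2} {Ls : ℕ → ℕ}
    (h : ω.IsTorusLimitOfMixture (sectorGibbsCount n) (fun L => sectorGibbsWeightTT' β t s U n L)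
      (fun L => sectorGibbsVectorTT' t s U n L) Ls) (hLs : Tendsto Ls atTop atTop) :
    ω.meanEnergy (hubbardTTPrimeFermionInteraction t s₀ U) 1 ≤
      u₀ + 2 * Real.binEntropy (n / 2) / β + (s - s₀) * (A₀ - B₂) := by
  obtain ⟨ψ₀, φ₀, ω₀, hφ₀, hψ₀, h1₀, h₀, -, -, -⟩ :=
    exists_isTorusLimitOf_sectorGroundState_TT' t s₀ U hn0 hn2.le tendsto_id
  have hL₀ : Tendsto (id ∘ φ₀) atTop atTop := tendsto_id.comp hφ₀.tendsto_atTop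
  have hgs := h.meanEnergy_anchor_le_of_groundState_of_sectorGibbs t s₀ s hU hn0 hn2 hβ hLs h₀
    hL₀ (fun j => hψ₀ _) (fun j => h1₀ _)
  have hA := hA₀ ω₀ (id ∘ φ₀) ψ₀ hL₀ (fun j => hψ₀ _) (fun j => h1₀ _) h₀
  have hB := h.le_meanEnergy_diagHop_of_forall_right_of_sectorGibbs hn0 hn2.le hβ hs₂ hB₂ hLs
  have hd : 0 ≤ s - s₀ := sub_nonneg.2 h0s
  linarith [mul_le_mul_of_nonneg_left (sub_le_sub hA hB) hd]

/-- **Thermal anchor cap from WORDS, left of the anchor** (`s₁ ≤ s ≤ s₀`): a cap `e(t,s₀,U,n) ≤ u₀`,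
a ground-state `K₂`-FLOOR word `B₀` at the anchor and a THERMAL `K₂`-CEILING word `A₁` at `(β, s₁)`
give `e_{Φ(t,s₀,U)}(ω) ≤ u₀ + 2H_b(n/2)/β + (s₀ − s)(A₁ − B₀)`.
[cite: Israel1979, Lemma II.3.1] [cite: Lieb1973, §V (5.2)–(5.4)] -/
theorem IsTorusLimitOfMixture.meanEnergy_anchor_le_of_words_left_of_sectorGibbs (t : ℝ)
    {s₁ s s₀ : ℝ} (hs₁ : s₁ ≤ s) (hs0 : s ≤ s₀)
    {U : ℝ} (hU : 0 ≤ U) {n : ℝ} (hn0 : 0 ≤ n) (hn2 : n < 2) {β : ℝ} (hβ : 0 < β) {u₀ A₁ B₀ : ℝ}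
    (hu₀ : energyDensityTT' t s₀ U n ≤ u₀)
    (hB₀ : ∀ (ω₀ : InfVolFermionState 2) (Ls₀ : ℕ → ℕ) (ψ₀ : ∀ L, Fock (Orb (FermionTorus 2 L))),
      Tendsto Ls₀ atTop atTop →
      (∀ j, IsGroundStateInSector (hubbardTorusTT' (Ls₀ j) t s₀ U) (rectN n (Ls₀ j)) 0 (ψ₀ (Ls₀ j))) →
      (∀ j, star (ψ₀ (Ls₀ j)) ⬝ᵥ ψ₀ (Ls₀ j) = 1) → ω₀.IsTorusLimitOf ψ₀ Ls₀ →
      B₀ ≤ ω₀.meanEnergy (hubbardTTPrimeFermionInteraction 0 1 0) 1)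
    (hA₁ : ∀ (ω₁ : InfVolFermionState 2) (Ls₁ : ℕ → ℕ), Tendsto Ls₁ atTop atTop →
      ω₁.IsTorusLimitOfMixture (sectorGibbsCount n) (fun L => sectorGibbsWeightTT' β t s₁ U n L)
        (fun L => sectorGibbsVectorTT' t s₁ U n L) Ls₁ →
      ω₁.meanEnergy (hubbardTTPrimeFermionInteraction 0 1 0) 1 ≤ A₁)
    {ω : InfVolFermionState 2} {Ls : ℕ → ℕ}
    (h : ω.IsTorusLimitOfMixture (sectorGibbsCount n) (fun L => sectorGibbsWeightTT' β t s U n L)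
      (fun L => sectorGibbsVectorTT' t s U n L) Ls) (hLs : Tendsto Ls atTop atTop) :
    ω.meanEnergy (hubbardTTPrimeFermionInteraction t s₀ U) 1 ≤
      u₀ + 2 * Real.binEntropy (n / 2) / β + (s₀ - s) * (A₁ - B₀) := by
  obtain ⟨ψ₀, φ₀, ω₀, hφ₀, hψ₀, h1₀, h₀, -, -, -⟩ :=
    exists_isTorusLimitOf_sectorGroundState_TT' t s₀ U hn0 hn2.le tendsto_id
  have hL₀ : Tendsto (id ∘ φ₀) atTop atTop := tendsto_id.comp hφ₀.tendsto_atTop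
  have hgs := h.meanEnergy_anchor_le_of_groundState_of_sectorGibbs t s₀ s hU hn0 hn2 hβ hLs h₀
    hL₀ (fun j => hψ₀ _) (fun j => h1₀ _)
  have hB := hB₀ ω₀ (id ∘ φ₀) ψ₀ hL₀ (fun j => hψ₀ _) (fun j => h1₀ _) h₀
  have hA := h.meanEnergy_diagHop_le_of_forall_left_of_sectorGibbs hn0 hn2.le hβ hs₁ hA₁ hLs
  have hd : 0 ≤ s₀ - s := sub_nonneg.2 hs0
  have key : (s - s₀) * (ω₀.meanEnergy (hubbardTTPrimeFermionInteraction 0 1 0) 1 -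
      ω.meanEnergy (hubbardTTPrimeFermionInteraction 0 1 0) 1) =
      (s₀ - s) * (ω.meanEnergy (hubbardTTPrimeFermionInteraction 0 1 0) 1 -
        ω₀.meanEnergy (hubbardTTPrimeFermionInteraction 0 1 0) 1) := by ring
  linarith [mul_le_mul_of_nonneg_left (sub_le_sub hA hB) hd]

/-- **BOX ⇒ WORD at `T > 0`, kinematic form.** Suppose a property `P` of infinite-volume states has
been certified AT THE ANCHOR `(t, s₀, U)` for the thermal CAP CLASS: every torus limit along
`Ls → ∞` of finite mixtures — nonnegative weights summing to one, unit `rectN n L`-particle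
components — whose anchor energy satisfies `e_{Φ(t,s₀,U)}(ω) ≤ u` (the hypothesis class of an
eom-free certificate: cut / positivity / translation-invariance / kinematic rows, all valid for such
mixtures; pure torus limits are the one-component case). If `e(t,s₀,U,n) ≤ u₀` and the cap was booked
with the inflation `u ≥ u₀ + 2H_b(n/2)/β + (32/π²)·max(s₂ − s₀, s₀ − s₁)`, then `P ω` holds for EVERY
torus limit `ω` of the canonical sector Gibbs states of `H(t,s,U)` at density `n` and ANY inverse
temperature `β' ≥ β`, for EVERY `s ∈ [s₁, s₂]`: one anchor certificate words the whole
`(t'-box) × (T ≤ 1/β)` cell. The `T > 0` twin of `forall_groundState_tPrime_box_of_forall_cap_kinematic`.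
[cite: Israel1979, Lemma II.3.1] [cite: LiebLoss1993, §8, Theorem 8.2] -/
theorem forall_sectorGibbsLimit_tPrime_box_of_forall_cap_kinematic (t : ℝ) {s₁ s₂ : ℝ} (s₀ : ℝ)
    {U : ℝ} (hU : 0 ≤ U) {n : ℝ} (hn0 : 0 ≤ n) (hn2 : n < 2) {β : ℝ} (hβ : 0 < β) {u₀ u : ℝ}
    (hu₀ : energyDensityTT' t s₀ U n ≤ u₀)
    (hu : u₀ + 2 * Real.binEntropy (n / 2) / β + 32 / Real.pi ^ 2 * max (s₂ - s₀) (s₀ - s₁) ≤ u)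
    {P : InfVolFermionState 2 → Prop}
    (hP : ∀ (ω : InfVolFermionState 2) (m : ℕ → ℕ) (p : ∀ L, Fin (m L) → ℝ)
      (ψ : ∀ L, Fin (m L) → Fock (Orb (FermionTorus 2 L))) (Ls : ℕ → ℕ),
      Tendsto Ls atTop atTop → (∀ L i, 0 ≤ p L i) → (∀ L, ∑ i, p L i = 1) →
      (∀ L i, IsNParticle (rectN n L) (ψ L i)) → (∀ L i, star (ψ L i) ⬝ᵥ ψ L i = 1) →
      ω.IsTorusLimitOfMixture m p ψ Ls →
      ω.meanEnergy (hubbardTTPrimeFermionInteraction t s₀ U) 1 ≤ u → P ω)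
    {s : ℝ} (hs : s ∈ Set.Icc s₁ s₂) {β' : ℝ} (hβ' : β ≤ β')
    {ω : InfVolFermionState 2} {Ls : ℕ → ℕ}
    (h : ω.IsTorusLimitOfMixture (sectorGibbsCount n) (fun L => sectorGibbsWeightTT' β' t s U n L)
      (fun L => sectorGibbsVectorTT' t s U n L) Ls) (hLs : Tendsto Ls atTop atTop) : P ω := by
  have hβ'0 : 0 < β' := hβ.trans_le hβ'
  refine hP ω (sectorGibbsCount n) _ _ Ls hLs
    (fun L i => sectorGibbsWeightTT'_nonneg β' t s U n L i)
    (fun L => sum_sectorGibbsWeightTT' β' t s U hn0 hn2.le L)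
    (fun L i => isNParticle_sectorGibbsVectorTT' t s U n L i)
    (fun L i => star_sectorGibbsVectorTT'_dotProduct_self t s U n L i) h ?_
  have hwin := (h.meanEnergy_anchor_mem_Icc_kinematic_of_sectorGibbs t s₀ s hU hn0 hn2 hβ'0 hLs).2
  have hH : 0 ≤ 2 * Real.binEntropy (n / 2) :=
    mul_nonneg zero_le_two (Real.binEntropy_nonneg (by linarith) (by linarith))
  have hent : 2 * Real.binEntropy (n / 2) / β' ≤ 2 * Real.binEntropy (n / 2) / β :=
    div_le_div_of_nonneg_left hH hβ hβ'
  have hmax : |s - s₀| ≤ max (s₂ - s₀) (s₀ - s₁) := by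
    rcases le_total s₀ s with h0s | hs0
    · rw [abs_of_nonneg (sub_nonneg.2 h0s)]
      exact (sub_le_sub_right hs.2 _).trans (le_max_left _ _)
    · rw [abs_of_nonpos (sub_nonpos.2 hs0), neg_sub]
      exact (sub_le_sub_left hs.1 _).trans (le_max_right _ _)
  have hπ : 0 ≤ 32 / Real.pi ^ 2 := by positivity
  nlinarith [mul_le_mul_of_nonneg_left hmax hπ]

/-- **BOX ⇒ WORD at `T > 0`, priced by words** (fixed `β`): as above, with the cap booked as
`u ≥ u₀ + 2H_b(n/2)/β + max(0, (s₂ − s₀)(A₀ − B₂), (s₀ − s₁)(A₁ − B₀))` from a ground-state `K₂`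
window `[B₀, A₀]` at the anchor and THERMAL words `K₂ ≤ A₁` at `(β, s₁)`, `B₂ ≤ K₂` at `(β, s₂)`
(`s₀ ∈ [s₁, s₂]`; the thermal words may be the kinematic `∓16/π²`): `P ω` for every torus limit of the canonical sector Gibbs states at `(β, n)` and
every `s ∈ [s₁, s₂]`. The `T > 0` twin of `forall_groundState_tPrime_box_of_forall_cap`.
[cite: Israel1979, Lemma II.3.1] [cite: Lieb1973, §V (5.2)–(5.4)] -/
theorem forall_sectorGibbsLimit_tPrime_box_of_forall_cap (t : ℝ) {s₁ s₂ : ℝ} (s₀ : ℝ)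
    {U : ℝ} (hU : 0 ≤ U) {n : ℝ} (hn0 : 0 ≤ n) (hn2 : n < 2)
    {β : ℝ} (hβ : 0 < β) {u₀ u A₀ B₀ A₁ B₂ : ℝ}
    (hu₀ : energyDensityTT' t s₀ U n ≤ u₀)
    (hA₀ : ∀ (ω₀ : InfVolFermionState 2) (Ls₀ : ℕ → ℕ) (ψ₀ : ∀ L, Fock (Orb (FermionTorus 2 L))),
      Tendsto Ls₀ atTop atTop →
      (∀ j, IsGroundStateInSector (hubbardTorusTT' (Ls₀ j) t s₀ U) (rectN n (Ls₀ j)) 0 (ψ₀ (Ls₀ j))) →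
      (∀ j, star (ψ₀ (Ls₀ j)) ⬝ᵥ ψ₀ (Ls₀ j) = 1) → ω₀.IsTorusLimitOf ψ₀ Ls₀ →
      ω₀.meanEnergy (hubbardTTPrimeFermionInteraction 0 1 0) 1 ≤ A₀)
    (hB₀ : ∀ (ω₀ : InfVolFermionState 2) (Ls₀ : ℕ → ℕ) (ψ₀ : ∀ L, Fock (Orb (FermionTorus 2 L))),
      Tendsto Ls₀ atTop atTop →
      (∀ j, IsGroundStateInSector (hubbardTorusTT' (Ls₀ j) t s₀ U) (rectN n (Ls₀ j)) 0 (ψ₀ (Ls₀ j))) →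
      (∀ j, star (ψ₀ (Ls₀ j)) ⬝ᵥ ψ₀ (Ls₀ j) = 1) → ω₀.IsTorusLimitOf ψ₀ Ls₀ →
      B₀ ≤ ω₀.meanEnergy (hubbardTTPrimeFermionInteraction 0 1 0) 1)
    (hA₁ : ∀ (ω₁ : InfVolFermionState 2) (Ls₁ : ℕ → ℕ), Tendsto Ls₁ atTop atTop →
      ω₁.IsTorusLimitOfMixture (sectorGibbsCount n) (fun L => sectorGibbsWeightTT' β t s₁ U n L)
        (fun L => sectorGibbsVectorTT' t s₁ U n L) Ls₁ →
      ω₁.meanEnergy (hubbardTTPrimeFermionInteraction 0 1 0) 1 ≤ A₁)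
    (hB₂ : ∀ (ω₂ : InfVolFermionState 2) (Ls₂ : ℕ → ℕ), Tendsto Ls₂ atTop atTop →
      ω₂.IsTorusLimitOfMixture (sectorGibbsCount n) (fun L => sectorGibbsWeightTT' β t s₂ U n L)
        (fun L => sectorGibbsVectorTT' t s₂ U n L) Ls₂ →
      B₂ ≤ ω₂.meanEnergy (hubbardTTPrimeFermionInteraction 0 1 0) 1)
    (hu : u₀ + 2 * Real.binEntropy (n / 2) / β +
      max 0 (max ((s₂ - s₀) * (A₀ - B₂)) ((s₀ - s₁) * (A₁ - B₀))) ≤ u)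
    {P : InfVolFermionState 2 → Prop}
    (hP : ∀ (ω : InfVolFermionState 2) (m : ℕ → ℕ) (p : ∀ L, Fin (m L) → ℝ)
      (ψ : ∀ L, Fin (m L) → Fock (Orb (FermionTorus 2 L))) (Ls : ℕ → ℕ),
      Tendsto Ls atTop atTop → (∀ L i, 0 ≤ p L i) → (∀ L, ∑ i, p L i = 1) →
      (∀ L i, IsNParticle (rectN n L) (ψ L i)) → (∀ L i, star (ψ L i) ⬝ᵥ ψ L i = 1) →
      ω.IsTorusLimitOfMixture m p ψ Ls →
      ω.meanEnergy (hubbardTTPrimeFermionInteraction t s₀ U) 1 ≤ u → P ω)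
    {s : ℝ} (hs : s ∈ Set.Icc s₁ s₂)
    {ω : InfVolFermionState 2} {Ls : ℕ → ℕ}
    (h : ω.IsTorusLimitOfMixture (sectorGibbsCount n) (fun L => sectorGibbsWeightTT' β t s U n L)
      (fun L => sectorGibbsVectorTT' t s U n L) Ls) (hLs : Tendsto Ls atTop atTop) : P ω := by
  refine hP ω (sectorGibbsCount n) _ _ Ls hLs
    (fun L i => sectorGibbsWeightTT'_nonneg β t s U n L i)
    (fun L => sum_sectorGibbsWeightTT' β t s U hn0 hn2.le L)
    (fun L i => isNParticle_sectorGibbsVectorTT' t s U n L i)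
    (fun L i => star_sectorGibbsVectorTT'_dotProduct_self t s U n L i) h ?_
  rcases le_total s₀ s with h0s | hs0
  · have hr := h.meanEnergy_anchor_le_of_words_right_of_sectorGibbs t h0s hs.2 hU hn0 hn2 hβ hu₀
      hA₀ hB₂ hLs
    have hd : 0 ≤ s - s₀ := sub_nonneg.2 h0s
    have hle : (s - s₀) * (A₀ - B₂) ≤ max 0 (max ((s₂ - s₀) * (A₀ - B₂)) ((s₀ - s₁) * (A₁ - B₀))) := by
      rcases le_total 0 (A₀ - B₂) with hpos | hneg
      · exact ((mul_le_mul_of_nonneg_right (sub_le_sub_right hs.2 _) hpos).trans (le_max_left _ _)).trans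
          (le_max_right _ _)
      · exact le_trans (by nlinarith) (le_max_left _ _)
    linarith
  · have hl := h.meanEnergy_anchor_le_of_words_left_of_sectorGibbs t hs.1 hs0 hU hn0 hn2 hβ hu₀
      hB₀ hA₁ hLs
    have hd : 0 ≤ s₀ - s := sub_nonneg.2 hs0
    have hle : (s₀ - s) * (A₁ - B₀) ≤ max 0 (max ((s₂ - s₀) * (A₀ - B₂)) ((s₀ - s₁) * (A₁ - B₀))) := by
      rcases le_total 0 (A₁ - B₀) with hpos | hneg
      · exact ((mul_le_mul_of_nonneg_right (sub_le_sub_left hs.1 _) hpos).trans (le_max_right _ _)).trans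
          (le_max_right _ _)
      · exact le_trans (by nlinarith) (le_max_left _ _)
    linarith

end InfVolFermionState


/-! ### §7 The thermal energy window on a `t'`-box -/

namespace InfVolFermionState

/-- **Two-sided window on the thermal energy density over a `t'`-BOX × temperature range.** From
certified floors `lo₁ ≤ e(t,s₁,U,n)`, `lo₂ ≤ e(t,s₂,U,n)` at the box endpoints and a cap
`e(t,s₀,U,n) ≤ u₀` at an anchor, every torus limit `ω` of the canonical sector Gibbs states of
`H(t,s,U)` at density `n` and inverse temperature `β' ≥ β`, `s ∈ [s₁, s₂]`, satisfies
`min(lo₁, lo₂) ≤ e_{Φ(t,s,U)}(ω) ≤ u₀ + (16/π²)|s − s₀| + 2H_b(n/2)/β`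
(concavity floor `energyDensityTT'_ge_min_of_mem_Icc_tPrime` + cut row; kinematic cap transport
`energyDensityTT'_le_of_upperBound_tPrime_kinematic` + entropy cap, antitone in `β`).
[cite: Israel1979, Lemma II.3.1] [cite: Ruelle1969, §3.4] -/
theorem IsTorusLimitOfMixture.meanEnergy_hubbardTTPrime_mem_Icc_on_tPrime_box_of_sectorGibbs (t : ℝ)
    {s₁ s₂ s₀ s : ℝ} (hs : s ∈ Set.Icc s₁ s₂) {U : ℝ} (hU : 0 ≤ U) {n : ℝ} (hn0 : 0 ≤ n) (hn2 : n < 2)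
    {β : ℝ} (hβ : 0 < β) {lo₁ lo₂ u₀ : ℝ}
    (h₁ : lo₁ ≤ energyDensityTT' t s₁ U n) (h₂ : lo₂ ≤ energyDensityTT' t s₂ U n)
    (hu₀ : energyDensityTT' t s₀ U n ≤ u₀) {β' : ℝ} (hβ' : β ≤ β')
    {ω : InfVolFermionState 2} {Ls : ℕ → ℕ}
    (h : ω.IsTorusLimitOfMixture (sectorGibbsCount n) (fun L => sectorGibbsWeightTT' β' t s U n L)
      (fun L => sectorGibbsVectorTT' t s U n L) Ls) (hLs : Tendsto Ls atTop atTop) :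
    ω.meanEnergy (hubbardTTPrimeFermionInteraction t s U) 1 ∈
      Set.Icc (min lo₁ lo₂) (u₀ + 16 / Real.pi ^ 2 * |s - s₀| + 2 * Real.binEntropy (n / 2) / β) := by
  have hβ'0 : 0 < β' := hβ.trans_le hβ'
  refine ⟨(energyDensityTT'_ge_min_of_mem_Icc_tPrime t hU hn0 hn2 hs h₁ h₂).trans
    (h.energyDensityTT'_le_meanEnergy_of_sectorGibbs t s U hn0 hn2 β' hLs s hU), ?_⟩
  have hcap := h.meanEnergy_hubbardTTPrime_le_energyDensityTT'_add_binEntropy_div t s hU hn0 hn2 hβ'0 hLs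
  have hkin := energyDensityTT'_le_of_upperBound_tPrime_kinematic t hU hn0 hn2 (s := s₀) (s' := s) hu₀
  have hH : 0 ≤ 2 * Real.binEntropy (n / 2) :=
    mul_nonneg zero_le_two (Real.binEntropy_nonneg (by linarith) (by linarith))
  have hent : 2 * Real.binEntropy (n / 2) / β' ≤ 2 * Real.binEntropy (n / 2) / β :=
    div_le_div_of_nonneg_left hH hβ hβ'
  linarith

end InfVolFermionState


/-! ### §8 Free-energy (`log Z`) transport along `t'`: the finite-volume kinematic `K₂` row, the
Lipschitz bound `|log Z_L(s) − log Z_L(s₀)| ≤ 4β·N·|s − s₀|`, eventual transport of the chord inputs of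
`TorusSectorGibbsEnergyWindow`, and certified thermal words as eventual finite-volume slopes -/

section FreeEnergyTransport

variable {n : ℝ}

/-- `⟨ψ, (−A) ψ⟩ = −⟨ψ, A ψ⟩`. [folklore] -/
private theorem expect_neg' {κ : Type*} [Fintype κ] [DecidableEq κ]
    (A : Matrix (Finset κ) (Finset κ) ℂ) (ψ : Fock κ) : expect (-A) ψ = -expect A ψ := by
  unfold expect
  rw [Matrix.neg_mulVec, dotProduct_neg]

/-- **Finite-volume kinematic `K₂` row**: for every unit `N`-particle vector `ψ` of the `L × L` torus
(`L ≥ 3`, `N ≤ 2L²`), `|Re⟨ψ, H_L(0,1,0) ψ⟩| ≤ 4N` — the unit diagonal band `∓4 cos p₁ cos p₂` lies in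
`[−4, 4]`, so Lieb–Loss' free Fermi-sea bound (`TTPrimeFree.le_groundEnergy_hubbardTorusTT'` at
`μ = −4`) gives `−4N ≤ E_N(0,±1,0) ≤ Re⟨ψ, H_L(0,±1,0) ψ⟩`. [cite: LiebLoss1993, §8, Theorem 8.2] -/
theorem abs_re_expect_hubbardTorusTT'_diagHop_unit_le {L : ℕ} [NeZero L] (hL : 3 ≤ L) {N : ℕ}
    (hN : N ≤ 2 * L ^ 2) {ψ : Fock (Orb (FermionTorus 2 L))} (hψN : IsNParticle N ψ)
    (hψ1 : star ψ ⬝ᵥ ψ = 1) :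
    |(expect (hubbardTorusTT' L 0 1 0) ψ).re| ≤ 4 * N := by
  have hband : ∀ t' : ℝ, |t'| = 1 → ∀ k : TorusSite 2 L,
      min (TTPrimeFree.ttBand L 0 t' k - (-4)) 0 = 0 := by
    intro t' ht' k
    refine min_eq_right ?_
    have hc : |Real.cos (latticeMomentum L k 0) * Real.cos (latticeMomentum L k 1)| ≤ 1 := by
      rw [abs_mul]
      exact mul_le_one₀ (Real.abs_cos_le_one _) (abs_nonneg _) (Real.abs_cos_le_one _)
    have h1 : |t' * (4 * Real.cos (latticeMomentum L k 0) * Real.cos (latticeMomentum L k 1))| ≤ 4 := by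
      rw [abs_mul, ht', one_mul, mul_assoc, abs_mul, abs_of_pos (by norm_num : (0 : ℝ) < 4)]
      linarith
    have h2 := (abs_le.1 h1).2
    simp only [TTPrimeFree.ttBand, neg_zero, zero_mul, zero_add, neg_mul, sub_neg_eq_add]
    linarith
  have hlow : ∀ t' : ℝ, |t'| = 1 → -(4 : ℝ) * N ≤ (expect (hubbardTorusTT' L 0 t' 0) ψ).re := by
    intro t' ht'
    have h := TTPrimeFree.le_groundEnergy_hubbardTorusTT' hL 0 t' le_rfl (-4) hN
    simp only [hband t' ht', Finset.sum_const_zero, mul_zero, add_zero] at h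
    exact h.trans (LiebThm1.groundEnergy_le_re_expect _ hψN hψ1)
  have hneg : hubbardTorusTT' L 0 (-1) 0 = -hubbardTorusTT' L 0 1 0 := by
    rw [TTPrimeFree.hubbardTorusTT'_tzero_Uzero, TTPrimeFree.hubbardTorusTT'_tzero_Uzero, ← neg_smul,
      neg_neg, Complex.ofReal_neg, Complex.ofReal_one, neg_neg]
  have h1 := hlow 1 (by norm_num)
  have h2 := hlow (-1) (by norm_num)
  rw [hneg, expect_neg', Complex.neg_re] at h2
  rw [abs_le]
  constructor <;> linarith

/-- **Finite-volume kinematic `K₂` row for the canonical sector Gibbs mixture**: for `0 ≤ n ≤ 2`,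
`L ≥ 3` and every `β, t, s, U`,
`|Σ_i p_{L,i} Re⟨ψ_{L,i}, H_L(0,1,0) ψ_{L,i}⟩| ≤ 4 · rectN n L` (each component is a unit
`rectN n L`-particle vector, the weights are a probability vector). [cite: LiebLoss1993, §8, Theorem 8.2] -/
theorem abs_sectorGibbs_diagHopMean_le (hn0 : 0 ≤ n) (hn2 : n ≤ 2) {L : ℕ} [NeZero L] (hL : 3 ≤ L)
    (β t s U : ℝ) :
    |∑ i, sectorGibbsWeightTT' β t s U n L i *
        (expect (hubbardTorusTT' L 0 1 0) (sectorGibbsVectorTT' t s U n L i)).re| ≤ 4 * rectN n L := by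
  have hN : rectN n L ≤ 2 * L ^ 2 := by
    have h := rectN_le_two_mul hn0 hn2 L
    rw [sq]; exact h
  have hb : ∀ i, |(expect (hubbardTorusTT' L 0 1 0) (sectorGibbsVectorTT' t s U n L i)).re| ≤ 4 * rectN n L :=
    fun i => abs_re_expect_hubbardTorusTT'_diagHop_unit_le hL hN
      (isNParticle_sectorGibbsVectorTT' t s U n L i) (star_sectorGibbsVectorTT'_dotProduct_self t s U n L i)
  have hw0 := fun i => sectorGibbsWeightTT'_nonneg β t s U n L i
  have hw1 := sum_sectorGibbsWeightTT' β t s U hn0 hn2 L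
  rw [abs_le]
  constructor
  · calc -(4 * (rectN n L : ℝ)) = ∑ i, sectorGibbsWeightTT' β t s U n L i * (-(4 * rectN n L)) := by
          rw [← Finset.sum_mul, hw1, one_mul]
      _ ≤ _ := Finset.sum_le_sum fun i _ => mul_le_mul_of_nonneg_left (abs_le.1 (hb i)).1 (hw0 i)
  · calc _ ≤ ∑ i, sectorGibbsWeightTT' β t s U n L i * (4 * rectN n L) :=
          Finset.sum_le_sum fun i _ => mul_le_mul_of_nonneg_left (abs_le.1 (hb i)).2 (hw0 i)
      _ = 4 * rectN n L := by rw [← Finset.sum_mul, hw1, one_mul]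

/-- **Kinematic Lipschitz bound for the sector free energy along `t'`** (finite volume, `β ≥ 0`,
`0 ≤ n ≤ 2`, `L ≥ 3`): `|log Z_L(β,t,s₁,U) − log Z_L(β,t,s₂,U)| ≤ 4β · rectN n L · |s₁ − s₂|` — the
Peierls–Bogoliubov bracket `log_partitionFn_sector_sub_mem_Icc_tPrime` with the kinematic row
`abs_sectorGibbs_diagHopMean_le` at both ends. (Per site: `4βn|s₁ − s₂|`, the particle-number price,
versus the operator-norm Lipschitz constant `β‖H_L(s₁) − H_L(s₂)‖` of `abs_log_partitionFn_sub_log_partitionFn_le`.)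
[cite: Lieb1973, §V (5.2)–(5.4)] [cite: LiebLoss1993, §8, Theorem 8.2] -/
theorem abs_log_partitionFn_sector_sub_le_tPrime (hn0 : 0 ≤ n) (hn2 : n ≤ 2) {L : ℕ} [NeZero L]
    (hL : 3 ≤ L) (t U : ℝ) {β : ℝ} (hβ : 0 ≤ β) (s₁ s₂ : ℝ) :
    |Real.log (partitionFn β (sectorHamiltonianTT' t s₁ U n L)).re -
        Real.log (partitionFn β (sectorHamiltonianTT' t s₂ U n L)).re| ≤
      4 * β * rectN n L * |s₁ - s₂| := by
  have hb := log_partitionFn_sector_sub_mem_Icc_tPrime hn0 hn2 L t U β s₁ s₂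
  have hm₁ := abs_sectorGibbs_diagHopMean_le hn0 hn2 hL β t s₁ U
  have hm₂ := abs_sectorGibbs_diagHopMean_le hn0 hn2 hL β t s₂ U
  set m₁ := ∑ i, sectorGibbsWeightTT' β t s₁ U n L i *
    (expect (hubbardTorusTT' L 0 1 0) (sectorGibbsVectorTT' t s₁ U n L i)).re with hm₁def
  set m₂ := ∑ i, sectorGibbsWeightTT' β t s₂ U n L i *
    (expect (hubbardTorusTT' L 0 1 0) (sectorGibbsVectorTT' t s₂ U n L i)).re with hm₂def
  have hlo : -(4 * β * rectN n L * |s₁ - s₂|) ≤ β * ((s₂ - s₁) * m₂) := by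
    have h1 : |(s₂ - s₁) * m₂| ≤ |s₁ - s₂| * (4 * rectN n L) := by
      rw [abs_mul, abs_sub_comm]
      exact mul_le_mul_of_nonneg_left hm₂ (abs_nonneg _)
    have h2 := (abs_le.1 h1).1
    nlinarith
  have hhi : β * ((s₂ - s₁) * m₁) ≤ 4 * β * rectN n L * |s₁ - s₂| := by
    have h1 : |(s₂ - s₁) * m₁| ≤ |s₁ - s₂| * (4 * rectN n L) := by
      rw [abs_mul, abs_sub_comm]
      exact mul_le_mul_of_nonneg_left hm₁ (abs_nonneg _)
    have h2 := (abs_le.1 h1).2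
    nlinarith
  exact abs_le.2 ⟨hlo.trans hb.1, hb.2.trans hhi⟩

/-- **Eventual transport of a free-energy LOWER input along `t'` (kinematic).** If along `Ls → ∞`
eventually `ℓ·L² ≤ log Z_{L,β}(t,s₀,U)` (`β ≥ 0`, `0 ≤ n ≤ 2`), then for every `s` eventually
`(ℓ − 4βn|s − s₀|)·L² ≤ log Z_{L,β}(t,s,U)` — the «cold»/«target» inputs of the chords of
`TorusSectorGibbsEnergyWindow` §2 certified at the anchor serve on the whole `t'`-box at this price.
[cite: Lieb1973, §V (5.2)–(5.4)] [cite: LiebLoss1993, §8, Theorem 8.2] -/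
theorem eventually_mul_sq_le_log_partitionFn_sector_of_tPrime (hn0 : 0 ≤ n) (hn2 : n ≤ 2) (t U : ℝ)
    {β : ℝ} (hβ : 0 ≤ β) (s₀ s : ℝ) {Ls : ℕ → ℕ} (hLs : Tendsto Ls atTop atTop) {ℓ : ℝ}
    (hℓ : ∀ᶠ j in atTop, ℓ * (Ls j : ℝ) ^ 2 ≤
      Real.log (partitionFn β (sectorHamiltonianTT' t s₀ U n (Ls j))).re) :
    ∀ᶠ j in atTop, (ℓ - 4 * β * n * |s - s₀|) * (Ls j : ℝ) ^ 2 ≤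
      Real.log (partitionFn β (sectorHamiltonianTT' t s U n (Ls j))).re := by
  filter_upwards [hℓ, hLs.eventually_ge_atTop 3] with j hj hL
  haveI : NeZero (Ls j) := ⟨by omega⟩
  have h := abs_log_partitionFn_sector_sub_le_tPrime hn0 hn2 hL t U hβ s₀ s
  have hr : (rectN n (Ls j) : ℝ) ≤ n * (Ls j : ℝ) ^ 2 := rectN_le hn0 (Ls j)
  have h2 := (abs_le.1 h).2
  have h3 : 4 * β * (rectN n (Ls j) : ℝ) * |s₀ - s| ≤ 4 * β * (n * (Ls j : ℝ) ^ 2) * |s - s₀| := by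
    rw [abs_sub_comm]
    exact mul_le_mul_of_nonneg_right (mul_le_mul_of_nonneg_left hr (by positivity)) (abs_nonneg _)
  nlinarith

/-- **Eventual transport of a free-energy UPPER input along `t'` (kinematic)**: if eventually
`log Z_{L,β}(t,s₀,U) ≤ u·L²`, then for every `s` eventually `log Z_{L,β}(t,s,U) ≤ (u + 4βn|s − s₀|)·L²`
(the «hot» input of the hot chord). [cite: Lieb1973, §V (5.2)–(5.4)] [cite: LiebLoss1993, §8, Theorem 8.2] -/
theorem eventually_log_partitionFn_sector_le_mul_sq_of_tPrime (hn0 : 0 ≤ n) (hn2 : n ≤ 2) (t U : ℝ)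
    {β : ℝ} (hβ : 0 ≤ β) (s₀ s : ℝ) {Ls : ℕ → ℕ} (hLs : Tendsto Ls atTop atTop) {u : ℝ}
    (hu : ∀ᶠ j in atTop, Real.log (partitionFn β (sectorHamiltonianTT' t s₀ U n (Ls j))).re ≤
      u * (Ls j : ℝ) ^ 2) :
    ∀ᶠ j in atTop, Real.log (partitionFn β (sectorHamiltonianTT' t s U n (Ls j))).re ≤
      (u + 4 * β * n * |s - s₀|) * (Ls j : ℝ) ^ 2 := by
  filter_upwards [hu, hLs.eventually_ge_atTop 3] with j hj hL
  haveI : NeZero (Ls j) := ⟨by omega⟩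
  have h := abs_log_partitionFn_sector_sub_le_tPrime hn0 hn2 hL t U hβ s₀ s
  have hr : (rectN n (Ls j) : ℝ) ≤ n * (Ls j : ℝ) ^ 2 := rectN_le hn0 (Ls j)
  have h2 := (abs_le.1 h).1
  have h3 : 4 * β * (rectN n (Ls j) : ℝ) * |s₀ - s| ≤ 4 * β * (n * (Ls j : ℝ) ^ 2) * |s - s₀| := by
    rw [abs_sub_comm]
    exact mul_le_mul_of_nonneg_right (mul_le_mul_of_nonneg_left hr (by positivity)) (abs_nonneg _)
  nlinarith

/-- **The hot chord on the whole `t'`-box from inputs at ONE anchor** (composition with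
`IsTorusLimitOfMixture.meanEnergy_hubbardTTPrime_le_chord_of_sectorGibbs`): eventual inputs
`ℓ·L² ≤ log Z_{L,β}(t,s₀,U)` and `log Z_{L,β_h}(t,s₀,U) ≤ u_h·L²` (`0 < β_h < β`) give, for every thermal
torus limit `ω` at `(β, t, s, U, n)` along the same tori,
`e_{Φ(t,s,U)}(ω) ≤ (u_h − ℓ + 4n|s − s₀|(β + β_h))/(β − β_h)`. [cite: Ruelle1969, §2.5] [cite: Lieb1973, §V (5.2)–(5.4)] -/
theorem IsTorusLimitOfMixture.meanEnergy_hubbardTTPrime_le_chord_of_anchor_inputs (hn0 : 0 ≤ n)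
    (hn2 : n ≤ 2) (t U s₀ s : ℝ) {β βh : ℝ} (hβh : 0 < βh) (hlt : βh < β)
    {ω : InfVolFermionState 2} {Ls : ℕ → ℕ}
    (h : ω.IsTorusLimitOfMixture (sectorGibbsCount n) (fun L => sectorGibbsWeightTT' β t s U n L)
      (fun L => sectorGibbsVectorTT' t s U n L) Ls) (hLs : Tendsto Ls atTop atTop) {ℓ uh : ℝ}
    (hℓ : ∀ᶠ j in atTop, ℓ * (Ls j : ℝ) ^ 2 ≤
      Real.log (partitionFn β (sectorHamiltonianTT' t s₀ U n (Ls j))).re)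
    (huh : ∀ᶠ j in atTop, Real.log (partitionFn βh (sectorHamiltonianTT' t s₀ U n (Ls j))).re ≤
      uh * (Ls j : ℝ) ^ 2) :
    ω.meanEnergy (hubbardTTPrimeFermionInteraction t s U) 1 ≤
      (uh + 4 * βh * n * |s - s₀| - (ℓ - 4 * β * n * |s - s₀|)) / (β - βh) :=
  h.meanEnergy_hubbardTTPrime_le_chord_of_sectorGibbs hn0 hn2 hLs hβh hlt
    (eventually_mul_sq_le_log_partitionFn_sector_of_tPrime hn0 hn2 t U (hβh.trans hlt).le s₀ s hLs hℓ)
    (eventually_log_partitionFn_sector_le_mul_sq_of_tPrime hn0 hn2 t U hβh.le s₀ s hLs huh)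

end FreeEnergyTransport

/-! ### §9 Certified thermal `K₂` words are eventual finite-volume slopes (compactness), and the
word-priced transport of free-energy lower inputs -/

namespace InfVolFermionState

variable {t U n β : ℝ}

/-- **A thermal `K₂`-ceiling word bounds the finite-volume thermal `K₂`-means eventually.** If
`K₂(ω) ≤ A` for every torus limit of the canonical sector Gibbs states at `(β, t, s, U, n)` (any tori),
then along every `Ls → ∞` and for every `ε > 0`, eventually
`Σ_i p_{Ls j,i} Re⟨ψ_i, H_{Ls j}(0,1,0) ψ_i⟩ ≤ (A + ε)·(Ls j)²`. Proof by compactness: otherwise a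
subsequence violates it, a further subsequence has a torus limit (`exists_isTorusLimitOfMixture_sectorGibbs`),
whose `K₂` is the limit of the means per site (`tendsto_meanEnergy_hubbardTTPrime 0 1 0`), hence
`≥ A + ε`. [cite: BratteliRobinsonI1987, Thm. 2.3.15 (weak-⋆ compactness of the state space) and §4.3.1] -/
theorem eventually_sectorGibbs_diagHopMean_le_of_forall (hn0 : 0 ≤ n) (hn2 : n ≤ 2) {s A : ℝ}
    (hA : ∀ (ω : InfVolFermionState 2) (Ls : ℕ → ℕ), Tendsto Ls atTop atTop →
      ω.IsTorusLimitOfMixture (sectorGibbsCount n) (fun L => sectorGibbsWeightTT' β t s U n L)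
        (fun L => sectorGibbsVectorTT' t s U n L) Ls →
      ω.meanEnergy (hubbardTTPrimeFermionInteraction 0 1 0) 1 ≤ A)
    {Ls : ℕ → ℕ} (hLs : Tendsto Ls atTop atTop) {ε : ℝ} (hε : 0 < ε) :
    ∀ᶠ j in atTop, ∑ i, sectorGibbsWeightTT' β t s U n (Ls j) i *
        (QuantumLattice.expect (hubbardTorusTT' (Ls j) 0 1 0) (sectorGibbsVectorTT' t s U n (Ls j) i)).re ≤
      (A + ε) * (Ls j : ℝ) ^ 2 := by
  by_contra hcon
  rw [Filter.not_eventually] at hcon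
  obtain ⟨φ, hφ, hφP⟩ := Filter.extraction_of_frequently_atTop hcon
  have hLφ : Tendsto (Ls ∘ φ) atTop atTop := hLs.comp hφ.tendsto_atTop
  obtain ⟨φ', hφ', ω, hω⟩ := exists_isTorusLimitOfMixture_sectorGibbs β t s U hn0 hn2 hLφ
  have hLφφ : Tendsto ((Ls ∘ φ) ∘ φ') atTop atTop := hLφ.comp hφ'.tendsto_atTop
  have hlim := hω.tendsto_meanEnergy_hubbardTTPrime 0 1 0 hLφφ
  have hge : A + ε ≤ ω.meanEnergy (hubbardTTPrimeFermionInteraction 0 1 0) 1 := by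
    refine ge_of_tendsto hlim ?_
    filter_upwards [hLφφ.eventually_ge_atTop 1] with j hj
    have hj' : 1 ≤ Ls (φ (φ' j)) := hj
    have hL1 : (0 : ℝ) < (Ls (φ (φ' j)) : ℝ) := by exact_mod_cast hj'
    have hL2 : (0 : ℝ) < (Ls (φ (φ' j)) : ℝ) ^ 2 := by positivity
    have hnot := hφP (φ' j)
    rw [not_le] at hnot
    have hsum : ∑ i, sectorGibbsWeightTT' β t s U n (Ls (φ (φ' j))) i *
        ((QuantumLattice.expect (hubbardTorusTT' (Ls (φ (φ' j))) 0 1 0)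
          (sectorGibbsVectorTT' t s U n (Ls (φ (φ' j))) i)).re / (Ls (φ (φ' j)) : ℝ) ^ 2) =
        (∑ i, sectorGibbsWeightTT' β t s U n (Ls (φ (φ' j))) i *
          (QuantumLattice.expect (hubbardTorusTT' (Ls (φ (φ' j))) 0 1 0)
            (sectorGibbsVectorTT' t s U n (Ls (φ (φ' j))) i)).re) / (Ls (φ (φ' j)) : ℝ) ^ 2 := by
      rw [Finset.sum_div]
      exact Finset.sum_congr rfl fun i _ => by ring
    show A + ε ≤ ∑ i, sectorGibbsWeightTT' β t s U n (Ls (φ (φ' j))) i *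
        ((QuantumLattice.expect (hubbardTorusTT' (Ls (φ (φ' j))) 0 1 0)
          (sectorGibbsVectorTT' t s U n (Ls (φ (φ' j))) i)).re / (Ls (φ (φ' j)) : ℝ) ^ 2)
    rw [hsum, le_div_iff₀ hL2]
    exact hnot.le
  have hω' := hA ω ((Ls ∘ φ) ∘ φ') hLφφ hω
  linarith

/-- **A thermal `K₂`-floor word bounds the finite-volume thermal `K₂`-means eventually from below**:
`B ≤ K₂(ω)` for every thermal torus limit at `(β, t, s, U, n)` gives, along every `Ls → ∞` and for
every `ε > 0`, eventually `(B − ε)·(Ls j)² ≤ Σ_i p_{Ls j,i} Re⟨ψ_i, H_{Ls j}(0,1,0) ψ_i⟩`.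
[cite: BratteliRobinsonI1987, Thm. 2.3.15 (weak-⋆ compactness of the state space) and §4.3.1] -/
theorem eventually_le_sectorGibbs_diagHopMean_of_forall (hn0 : 0 ≤ n) (hn2 : n ≤ 2) {s B : ℝ}
    (hB : ∀ (ω : InfVolFermionState 2) (Ls : ℕ → ℕ), Tendsto Ls atTop atTop →
      ω.IsTorusLimitOfMixture (sectorGibbsCount n) (fun L => sectorGibbsWeightTT' β t s U n L)
        (fun L => sectorGibbsVectorTT' t s U n L) Ls →
      B ≤ ω.meanEnergy (hubbardTTPrimeFermionInteraction 0 1 0) 1)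
    {Ls : ℕ → ℕ} (hLs : Tendsto Ls atTop atTop) {ε : ℝ} (hε : 0 < ε) :
    ∀ᶠ j in atTop, (B - ε) * (Ls j : ℝ) ^ 2 ≤ ∑ i, sectorGibbsWeightTT' β t s U n (Ls j) i *
        (QuantumLattice.expect (hubbardTorusTT' (Ls j) 0 1 0) (sectorGibbsVectorTT' t s U n (Ls j) i)).re := by
  by_contra hcon
  rw [Filter.not_eventually] at hcon
  obtain ⟨φ, hφ, hφP⟩ := Filter.extraction_of_frequently_atTop hcon
  have hLφ : Tendsto (Ls ∘ φ) atTop atTop := hLs.comp hφ.tendsto_atTop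
  obtain ⟨φ', hφ', ω, hω⟩ := exists_isTorusLimitOfMixture_sectorGibbs β t s U hn0 hn2 hLφ
  have hLφφ : Tendsto ((Ls ∘ φ) ∘ φ') atTop atTop := hLφ.comp hφ'.tendsto_atTop
  have hlim := hω.tendsto_meanEnergy_hubbardTTPrime 0 1 0 hLφφ
  have hle : ω.meanEnergy (hubbardTTPrimeFermionInteraction 0 1 0) 1 ≤ B - ε := by
    refine le_of_tendsto hlim ?_
    filter_upwards [hLφφ.eventually_ge_atTop 1] with j hj
    have hj' : 1 ≤ Ls (φ (φ' j)) := hj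
    have hL1 : (0 : ℝ) < (Ls (φ (φ' j)) : ℝ) := by exact_mod_cast hj'
    have hL2 : (0 : ℝ) < (Ls (φ (φ' j)) : ℝ) ^ 2 := by positivity
    have hnot := hφP (φ' j)
    rw [not_le] at hnot
    have hsum : ∑ i, sectorGibbsWeightTT' β t s U n (Ls (φ (φ' j))) i *
        ((QuantumLattice.expect (hubbardTorusTT' (Ls (φ (φ' j))) 0 1 0)
          (sectorGibbsVectorTT' t s U n (Ls (φ (φ' j))) i)).re / (Ls (φ (φ' j)) : ℝ) ^ 2) =
        (∑ i, sectorGibbsWeightTT' β t s U n (Ls (φ (φ' j))) i *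
          (QuantumLattice.expect (hubbardTorusTT' (Ls (φ (φ' j))) 0 1 0)
            (sectorGibbsVectorTT' t s U n (Ls (φ (φ' j))) i)).re) / (Ls (φ (φ' j)) : ℝ) ^ 2 := by
      rw [Finset.sum_div]
      exact Finset.sum_congr rfl fun i _ => by ring
    show ∑ i, sectorGibbsWeightTT' β t s U n (Ls (φ (φ' j))) i *
        ((QuantumLattice.expect (hubbardTorusTT' (Ls (φ (φ' j))) 0 1 0)
          (sectorGibbsVectorTT' t s U n (Ls (φ (φ' j))) i)).re / (Ls (φ (φ' j)) : ℝ) ^ 2) ≤ B - ε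
    rw [hsum, div_le_iff₀ hL2]
    exact hnot.le
  have hω' := hB ω ((Ls ∘ φ) ∘ φ') hLφφ hω
  linarith

/-- **Word-priced eventual transport of a free-energy LOWER input, right of the anchor.** If eventually
`ℓ·L² ≤ log Z_{L,β}(t,s₀,U)` along `Ls → ∞` (`β > 0`, `0 ≤ n ≤ 2`) and `A₀` is a thermal `K₂`-CEILING word
at `(β, s₀)`, then for every `s ≥ s₀` and every `ε > 0`, eventually
`(ℓ − β(s − s₀)(A₀ + ε))·L² ≤ log Z_{L,β}(t,s,U)` (Peierls–Bogoliubov at the anchor: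
`log Z_L(s₀) − log Z_L(s) ≤ β(s − s₀)⟨K⟩_{L,s₀}`). [cite: Lieb1973, §V (5.2)–(5.4)] -/
theorem eventually_mul_sq_le_log_partitionFn_sector_of_word_right (hn0 : 0 ≤ n) (hn2 : n ≤ 2)
    (hβ : 0 < β) {s₀ s : ℝ} (h0s : s₀ ≤ s) {A₀ : ℝ}
    (hA₀ : ∀ (ω : InfVolFermionState 2) (Ls : ℕ → ℕ), Tendsto Ls atTop atTop →
      ω.IsTorusLimitOfMixture (sectorGibbsCount n) (fun L => sectorGibbsWeightTT' β t s₀ U n L)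
        (fun L => sectorGibbsVectorTT' t s₀ U n L) Ls →
      ω.meanEnergy (hubbardTTPrimeFermionInteraction 0 1 0) 1 ≤ A₀)
    {Ls : ℕ → ℕ} (hLs : Tendsto Ls atTop atTop) {ℓ : ℝ}
    (hℓ : ∀ᶠ j in atTop, ℓ * (Ls j : ℝ) ^ 2 ≤
      Real.log (partitionFn β (sectorHamiltonianTT' t s₀ U n (Ls j))).re)
    {ε : ℝ} (hε : 0 < ε) :
    ∀ᶠ j in atTop, (ℓ - β * (s - s₀) * (A₀ + ε)) * (Ls j : ℝ) ^ 2 ≤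
      Real.log (partitionFn β (sectorHamiltonianTT' t s U n (Ls j))).re := by
  filter_upwards [hℓ, eventually_sectorGibbs_diagHopMean_le_of_forall hn0 hn2 hA₀ hLs hε,
    hLs.eventually_ge_atTop 1] with j hj hm hL
  haveI : NeZero (Ls j) := ⟨by omega⟩
  have hb := (log_partitionFn_sector_sub_mem_Icc_tPrime hn0 hn2 (Ls j) t U β s₀ s).2
  have h2 : β * ((s - s₀) * ∑ i, sectorGibbsWeightTT' β t s₀ U n (Ls j) i *
      (QuantumLattice.expect (hubbardTorusTT' (Ls j) 0 1 0) (sectorGibbsVectorTT' t s₀ U n (Ls j) i)).re) ≤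
      β * ((s - s₀) * ((A₀ + ε) * (Ls j : ℝ) ^ 2)) :=
    mul_le_mul_of_nonneg_left (mul_le_mul_of_nonneg_left hm (sub_nonneg.2 h0s)) hβ.le
  have h3 : (ℓ - β * (s - s₀) * (A₀ + ε)) * (Ls j : ℝ) ^ 2 =
      ℓ * (Ls j : ℝ) ^ 2 - β * ((s - s₀) * ((A₀ + ε) * (Ls j : ℝ) ^ 2)) := by ring
  rw [h3]
  linarith

/-- **Word-priced eventual transport of a free-energy LOWER input, left of the anchor**: with a thermal
`K₂`-FLOOR word `B₀` at `(β, s₀)`, for every `s ≤ s₀` and `ε > 0`, eventually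
`(ℓ − β(s₀ − s)(ε − B₀))·L² ≤ log Z_{L,β}(t,s,U)`. [cite: Lieb1973, §V (5.2)–(5.4)] -/
theorem eventually_mul_sq_le_log_partitionFn_sector_of_word_left (hn0 : 0 ≤ n) (hn2 : n ≤ 2)
    (hβ : 0 < β) {s s₀ : ℝ} (hs0 : s ≤ s₀) {B₀ : ℝ}
    (hB₀ : ∀ (ω : InfVolFermionState 2) (Ls : ℕ → ℕ), Tendsto Ls atTop atTop →
      ω.IsTorusLimitOfMixture (sectorGibbsCount n) (fun L => sectorGibbsWeightTT' β t s₀ U n L)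
        (fun L => sectorGibbsVectorTT' t s₀ U n L) Ls →
      B₀ ≤ ω.meanEnergy (hubbardTTPrimeFermionInteraction 0 1 0) 1)
    {Ls : ℕ → ℕ} (hLs : Tendsto Ls atTop atTop) {ℓ : ℝ}
    (hℓ : ∀ᶠ j in atTop, ℓ * (Ls j : ℝ) ^ 2 ≤
      Real.log (partitionFn β (sectorHamiltonianTT' t s₀ U n (Ls j))).re)
    {ε : ℝ} (hε : 0 < ε) :
    ∀ᶠ j in atTop, (ℓ - β * (s₀ - s) * (ε - B₀)) * (Ls j : ℝ) ^ 2 ≤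
      Real.log (partitionFn β (sectorHamiltonianTT' t s U n (Ls j))).re := by
  filter_upwards [hℓ, eventually_le_sectorGibbs_diagHopMean_of_forall hn0 hn2 hB₀ hLs hε,
    hLs.eventually_ge_atTop 1] with j hj hm hL
  haveI : NeZero (Ls j) := ⟨by omega⟩
  have hb := (log_partitionFn_sector_sub_mem_Icc_tPrime hn0 hn2 (Ls j) t U β s₀ s).2
  have h2 : β * ((s - s₀) * ∑ i, sectorGibbsWeightTT' β t s₀ U n (Ls j) i *
      (QuantumLattice.expect (hubbardTorusTT' (Ls j) 0 1 0) (sectorGibbsVectorTT' t s₀ U n (Ls j) i)).re) ≤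
      β * ((s - s₀) * ((B₀ - ε) * (Ls j : ℝ) ^ 2)) :=
    mul_le_mul_of_nonneg_left (mul_le_mul_of_nonpos_left hm (sub_nonpos.2 hs0)) hβ.le
  have h3 : (ℓ - β * (s₀ - s) * (ε - B₀)) * (Ls j : ℝ) ^ 2 =
      ℓ * (Ls j : ℝ) ^ 2 - β * ((s - s₀) * ((B₀ - ε) * (Ls j : ℝ) ^ 2)) := by ring
  rw [h3]
  linarith

end InfVolFermionState

/-! ### §10 UPPER free-energy inputs move with words at the FAR side of the target; the kinematic
eventual price is `16/π²` (not `4n`); the hot chord on the whole `t'`-box at that price -/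

namespace InfVolFermionState

section UpperInputs

variable {t U n β : ℝ}

/-- **Word-priced eventual transport of a free-energy UPPER input, right of the anchor.** If
eventually `log Z_{L,β}(t,s₀,U) ≤ u·L²` along `Ls → ∞` (`β > 0`, `0 ≤ n ≤ 2`) and `B₂` is a thermal
`K₂`-FLOOR word at `(β, s₂)` for some `s₂ ≥ s ≥ s₀` (a column on the FAR side of the target `s`), then
for every `ε > 0`, eventually `log Z_{L,β}(t,s,U) ≤ (u + β(s − s₀)(ε − B₂))·L²` (Peierls–Bogoliubov at
the TARGET, `β(s − s₀)⟨K⟩_{L,s} ≤ log Z_L(s₀) − log Z_L(s)`, with `⟨K⟩_{L,s} ≥ (B₂ − ε)L²` eventually: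
the floor word moved to `s` by §5 and made finite-volume by §9). The companion of
`eventually_mul_sq_le_log_partitionFn_sector_of_word_right` (LOWER input, word at the anchor).
[cite: Lieb1973, §V (5.2)–(5.4)] [cite: BratteliRobinsonI1987, Thm. 2.3.15 (weak-⋆ compactness of the state space) and §4.3.1] -/
theorem eventually_log_partitionFn_sector_le_mul_sq_of_word_right (hn0 : 0 ≤ n) (hn2 : n ≤ 2)
    (hβ : 0 < β) {s₀ s s₂ : ℝ} (h0s : s₀ ≤ s) (hs₂ : s ≤ s₂) {B₂ : ℝ}
    (hB₂ : ∀ (ω : InfVolFermionState 2) (Ls : ℕ → ℕ), Tendsto Ls atTop atTop →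
      ω.IsTorusLimitOfMixture (sectorGibbsCount n) (fun L => sectorGibbsWeightTT' β t s₂ U n L)
        (fun L => sectorGibbsVectorTT' t s₂ U n L) Ls →
      B₂ ≤ ω.meanEnergy (hubbardTTPrimeFermionInteraction 0 1 0) 1)
    {Ls : ℕ → ℕ} (hLs : Tendsto Ls atTop atTop) {u : ℝ}
    (hu : ∀ᶠ j in atTop, Real.log (partitionFn β (sectorHamiltonianTT' t s₀ U n (Ls j))).re ≤
      u * (Ls j : ℝ) ^ 2)
    {ε : ℝ} (hε : 0 < ε) :
    ∀ᶠ j in atTop, Real.log (partitionFn β (sectorHamiltonianTT' t s U n (Ls j))).re ≤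
      (u + β * (s - s₀) * (ε - B₂)) * (Ls j : ℝ) ^ 2 := by
  have hBs : ∀ (ω : InfVolFermionState 2) (Ls' : ℕ → ℕ), Tendsto Ls' atTop atTop →
      ω.IsTorusLimitOfMixture (sectorGibbsCount n) (fun L => sectorGibbsWeightTT' β t s U n L)
        (fun L => sectorGibbsVectorTT' t s U n L) Ls' →
      B₂ ≤ ω.meanEnergy (hubbardTTPrimeFermionInteraction 0 1 0) 1 :=
    fun ω Ls' hLs' hω =>
      hω.le_meanEnergy_diagHop_of_forall_right_of_sectorGibbs hn0 hn2 hβ hs₂ hB₂ hLs'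
  filter_upwards [hu, eventually_le_sectorGibbs_diagHopMean_of_forall hn0 hn2 hBs hLs hε,
    hLs.eventually_ge_atTop 1] with j hj hm hL
  haveI : NeZero (Ls j) := ⟨by omega⟩
  have hb := (log_partitionFn_sector_sub_mem_Icc_tPrime hn0 hn2 (Ls j) t U β s₀ s).1
  have h2 : β * ((s - s₀) * ((B₂ - ε) * (Ls j : ℝ) ^ 2)) ≤
      β * ((s - s₀) * ∑ i, sectorGibbsWeightTT' β t s U n (Ls j) i *
        (QuantumLattice.expect (hubbardTorusTT' (Ls j) 0 1 0) (sectorGibbsVectorTT' t s U n (Ls j) i)).re) :=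
    mul_le_mul_of_nonneg_left (mul_le_mul_of_nonneg_left hm (sub_nonneg.2 h0s)) hβ.le
  have h3 : (u + β * (s - s₀) * (ε - B₂)) * (Ls j : ℝ) ^ 2 =
      u * (Ls j : ℝ) ^ 2 - β * ((s - s₀) * ((B₂ - ε) * (Ls j : ℝ) ^ 2)) := by ring
  rw [h3]
  linarith

/-- **Word-priced eventual transport of a free-energy UPPER input, left of the anchor**: with a thermal
`K₂`-CEILING word `A₁` at `(β, s₁)`, `s₁ ≤ s ≤ s₀`, for every `ε > 0` eventually
`log Z_{L,β}(t,s,U) ≤ (u + β(s₀ − s)(A₁ + ε))·L²` (`log Z_L(s) − log Z_L(s₀) ≤ β(s₀ − s)⟨K⟩_{L,s}`).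
[cite: Lieb1973, §V (5.2)–(5.4)] [cite: BratteliRobinsonI1987, Thm. 2.3.15 (weak-⋆ compactness of the state space) and §4.3.1] -/
theorem eventually_log_partitionFn_sector_le_mul_sq_of_word_left (hn0 : 0 ≤ n) (hn2 : n ≤ 2)
    (hβ : 0 < β) {s₁ s s₀ : ℝ} (hs₁ : s₁ ≤ s) (hs0 : s ≤ s₀) {A₁ : ℝ}
    (hA₁ : ∀ (ω : InfVolFermionState 2) (Ls : ℕ → ℕ), Tendsto Ls atTop atTop →
      ω.IsTorusLimitOfMixture (sectorGibbsCount n) (fun L => sectorGibbsWeightTT' β t s₁ U n L)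
        (fun L => sectorGibbsVectorTT' t s₁ U n L) Ls →
      ω.meanEnergy (hubbardTTPrimeFermionInteraction 0 1 0) 1 ≤ A₁)
    {Ls : ℕ → ℕ} (hLs : Tendsto Ls atTop atTop) {u : ℝ}
    (hu : ∀ᶠ j in atTop, Real.log (partitionFn β (sectorHamiltonianTT' t s₀ U n (Ls j))).re ≤
      u * (Ls j : ℝ) ^ 2)
    {ε : ℝ} (hε : 0 < ε) :
    ∀ᶠ j in atTop, Real.log (partitionFn β (sectorHamiltonianTT' t s U n (Ls j))).re ≤
      (u + β * (s₀ - s) * (A₁ + ε)) * (Ls j : ℝ) ^ 2 := by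
  have hAs : ∀ (ω : InfVolFermionState 2) (Ls' : ℕ → ℕ), Tendsto Ls' atTop atTop →
      ω.IsTorusLimitOfMixture (sectorGibbsCount n) (fun L => sectorGibbsWeightTT' β t s U n L)
        (fun L => sectorGibbsVectorTT' t s U n L) Ls' →
      ω.meanEnergy (hubbardTTPrimeFermionInteraction 0 1 0) 1 ≤ A₁ :=
    fun ω Ls' hLs' hω =>
      hω.meanEnergy_diagHop_le_of_forall_left_of_sectorGibbs hn0 hn2 hβ hs₁ hA₁ hLs'
  filter_upwards [hu, eventually_sectorGibbs_diagHopMean_le_of_forall hn0 hn2 hAs hLs hε,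
    hLs.eventually_ge_atTop 1] with j hj hm hL
  haveI : NeZero (Ls j) := ⟨by omega⟩
  have hb := (log_partitionFn_sector_sub_mem_Icc_tPrime hn0 hn2 (Ls j) t U β s s₀).2
  have h2 : β * ((s₀ - s) * ∑ i, sectorGibbsWeightTT' β t s U n (Ls j) i *
      (QuantumLattice.expect (hubbardTorusTT' (Ls j) 0 1 0) (sectorGibbsVectorTT' t s U n (Ls j) i)).re) ≤
      β * ((s₀ - s) * ((A₁ + ε) * (Ls j : ℝ) ^ 2)) :=
    mul_le_mul_of_nonneg_left (mul_le_mul_of_nonneg_left hm (sub_nonneg.2 hs0)) hβ.le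
  have h3 : (u + β * (s₀ - s) * (A₁ + ε)) * (Ls j : ℝ) ^ 2 =
      u * (Ls j : ℝ) ^ 2 + β * ((s₀ - s) * ((A₁ + ε) * (Ls j : ℝ) ^ 2)) := by ring
  rw [h3]
  linarith

end UpperInputs

section KinematicSixteen

variable {n : ℝ}

/-- **The finite-volume thermal `K₂`-mean is eventually `≤ (16/π² + ε)L²`** along every `Ls → ∞`
(every `β`, `t`, `s`, `U`, `0 ≤ n < 2`, every `ε > 0`): §9 with the kinematic thermal ceiling word
`K₂ ≤ 16/π²` of the convention (`IsTorusLimitOfMixture.abs_meanEnergy_diagHop_le_of_sectorGibbs`), valid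
at every coupling. [cite: LiebLoss1993, §8, Theorem 8.2] [cite: BratteliRobinsonI1987, Thm. 2.3.15 (weak-⋆ compactness of the state space) and §4.3.1] -/
theorem eventually_sectorGibbs_diagHopMean_le_sixteen_div_pi_sq (hn0 : 0 ≤ n) (hn2 : n < 2)
    (β t s U : ℝ) {Ls : ℕ → ℕ} (hLs : Tendsto Ls atTop atTop) {ε : ℝ} (hε : 0 < ε) :
    ∀ᶠ j in atTop, ∑ i, sectorGibbsWeightTT' β t s U n (Ls j) i *
        (QuantumLattice.expect (hubbardTorusTT' (Ls j) 0 1 0) (sectorGibbsVectorTT' t s U n (Ls j) i)).re ≤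
      (16 / Real.pi ^ 2 + ε) * (Ls j : ℝ) ^ 2 :=
  eventually_sectorGibbs_diagHopMean_le_of_forall (β := β) (t := t) (U := U) (s := s) hn0 hn2.le
    (fun _ _ hLs' hω =>
      (abs_le.1 (hω.abs_meanEnergy_diagHop_le_of_sectorGibbs t s U hn0 hn2 β hLs')).2) hLs hε

/-- **The finite-volume thermal `K₂`-mean is eventually `≥ −(16/π² + ε)L²`** along every `Ls → ∞`
(the kinematic thermal floor word `−16/π² ≤ K₂` at every coupling, made finite-volume by §9).
[cite: LiebLoss1993, §8, Theorem 8.2] [cite: BratteliRobinsonI1987, Thm. 2.3.15 (weak-⋆ compactness of the state space) and §4.3.1] -/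
theorem eventually_neg_sixteen_div_pi_sq_le_sectorGibbs_diagHopMean (hn0 : 0 ≤ n) (hn2 : n < 2)
    (β t s U : ℝ) {Ls : ℕ → ℕ} (hLs : Tendsto Ls atTop atTop) {ε : ℝ} (hε : 0 < ε) :
    ∀ᶠ j in atTop, (-(16 / Real.pi ^ 2) - ε) * (Ls j : ℝ) ^ 2 ≤
      ∑ i, sectorGibbsWeightTT' β t s U n (Ls j) i *
        (QuantumLattice.expect (hubbardTorusTT' (Ls j) 0 1 0) (sectorGibbsVectorTT' t s U n (Ls j) i)).re :=
  eventually_le_sectorGibbs_diagHopMean_of_forall (β := β) (t := t) (U := U) (s := s) hn0 hn2.le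
    (fun _ _ hLs' hω =>
      (abs_le.1 (hω.abs_meanEnergy_diagHop_le_of_sectorGibbs t s U hn0 hn2 β hLs')).1) hLs hε

/-- **Eventual transport of a free-energy LOWER input along `t'` at the kinematic price `16/π²`.**
If eventually `ℓ·L² ≤ log Z_{L,β}(t,s₀,U)` along `Ls → ∞` (`β > 0`, `0 ≤ n < 2`), then for every `s`
and every `ε > 0`, eventually `(ℓ − β|s − s₀|(16/π² + ε))·L² ≤ log Z_{L,β}(t,s,U)` — §9's word-priced
transports with the kinematic words `±16/π²` at the anchor; against §8's `4βn|s − s₀|`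
(`eventually_mul_sq_le_log_partitionFn_sector_of_tPrime`), sharper for `n > 4/π² + ε/4`.
[cite: Lieb1973, §V (5.2)–(5.4)] [cite: LiebLoss1993, §8, Theorem 8.2] -/
theorem eventually_mul_sq_le_log_partitionFn_sector_of_tPrime_sixteen_div_pi_sq (hn0 : 0 ≤ n)
    (hn2 : n < 2) (t U : ℝ) {β : ℝ} (hβ : 0 < β) (s₀ s : ℝ) {Ls : ℕ → ℕ}
    (hLs : Tendsto Ls atTop atTop) {ℓ : ℝ}
    (hℓ : ∀ᶠ j in atTop, ℓ * (Ls j : ℝ) ^ 2 ≤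
      Real.log (partitionFn β (sectorHamiltonianTT' t s₀ U n (Ls j))).re)
    {ε : ℝ} (hε : 0 < ε) :
    ∀ᶠ j in atTop, (ℓ - β * |s - s₀| * (16 / Real.pi ^ 2 + ε)) * (Ls j : ℝ) ^ 2 ≤
      Real.log (partitionFn β (sectorHamiltonianTT' t s U n (Ls j))).re := by
  rcases le_total s₀ s with h0s | hs0
  · have hA₀ : ∀ (ω : InfVolFermionState 2) (Ls' : ℕ → ℕ), Tendsto Ls' atTop atTop →
        ω.IsTorusLimitOfMixture (sectorGibbsCount n) (fun L => sectorGibbsWeightTT' β t s₀ U n L)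
          (fun L => sectorGibbsVectorTT' t s₀ U n L) Ls' →
        ω.meanEnergy (hubbardTTPrimeFermionInteraction 0 1 0) 1 ≤ 16 / Real.pi ^ 2 :=
      fun ω Ls' hLs' hω =>
        (abs_le.1 (hω.abs_meanEnergy_diagHop_le_of_sectorGibbs t s₀ U hn0 hn2 β hLs')).2
    have h := eventually_mul_sq_le_log_partitionFn_sector_of_word_right hn0 hn2.le hβ h0s hA₀ hLs
      hℓ hε
    filter_upwards [h] with j hj
    refine le_trans (le_of_eq ?_) hj
    rw [abs_of_nonneg (sub_nonneg.2 h0s)]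
  · have hB₀ : ∀ (ω : InfVolFermionState 2) (Ls' : ℕ → ℕ), Tendsto Ls' atTop atTop →
        ω.IsTorusLimitOfMixture (sectorGibbsCount n) (fun L => sectorGibbsWeightTT' β t s₀ U n L)
          (fun L => sectorGibbsVectorTT' t s₀ U n L) Ls' →
        -(16 / Real.pi ^ 2) ≤ ω.meanEnergy (hubbardTTPrimeFermionInteraction 0 1 0) 1 :=
      fun ω Ls' hLs' hω =>
        (abs_le.1 (hω.abs_meanEnergy_diagHop_le_of_sectorGibbs t s₀ U hn0 hn2 β hLs')).1
    have h := eventually_mul_sq_le_log_partitionFn_sector_of_word_left hn0 hn2.le hβ hs0 hB₀ hLs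
      hℓ hε
    filter_upwards [h] with j hj
    refine le_trans (le_of_eq ?_) hj
    rw [abs_of_nonpos (sub_nonpos.2 hs0)]
    ring

/-- **Eventual transport of a free-energy UPPER input along `t'` at the kinematic price `16/π²`**:
if eventually `log Z_{L,β}(t,s₀,U) ≤ u·L²` (`β > 0`, `0 ≤ n < 2`), then for every `s` and every `ε > 0`,
eventually `log Z_{L,β}(t,s,U) ≤ (u + β|s − s₀|(16/π² + ε))·L²` (this section's upper transports with the
kinematic words at the target itself). [cite: Lieb1973, §V (5.2)–(5.4)] [cite: LiebLoss1993, §8, Theorem 8.2] -/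
theorem eventually_log_partitionFn_sector_le_mul_sq_of_tPrime_sixteen_div_pi_sq (hn0 : 0 ≤ n)
    (hn2 : n < 2) (t U : ℝ) {β : ℝ} (hβ : 0 < β) (s₀ s : ℝ) {Ls : ℕ → ℕ}
    (hLs : Tendsto Ls atTop atTop) {u : ℝ}
    (hu : ∀ᶠ j in atTop, Real.log (partitionFn β (sectorHamiltonianTT' t s₀ U n (Ls j))).re ≤
      u * (Ls j : ℝ) ^ 2)
    {ε : ℝ} (hε : 0 < ε) :
    ∀ᶠ j in atTop, Real.log (partitionFn β (sectorHamiltonianTT' t s U n (Ls j))).re ≤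
      (u + β * |s - s₀| * (16 / Real.pi ^ 2 + ε)) * (Ls j : ℝ) ^ 2 := by
  rcases le_total s₀ s with h0s | hs0
  · have hB : ∀ (ω : InfVolFermionState 2) (Ls' : ℕ → ℕ), Tendsto Ls' atTop atTop →
        ω.IsTorusLimitOfMixture (sectorGibbsCount n) (fun L => sectorGibbsWeightTT' β t s U n L)
          (fun L => sectorGibbsVectorTT' t s U n L) Ls' →
        -(16 / Real.pi ^ 2) ≤ ω.meanEnergy (hubbardTTPrimeFermionInteraction 0 1 0) 1 :=
      fun ω Ls' hLs' hω =>
        (abs_le.1 (hω.abs_meanEnergy_diagHop_le_of_sectorGibbs t s U hn0 hn2 β hLs')).1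
    have h := eventually_log_partitionFn_sector_le_mul_sq_of_word_right hn0 hn2.le hβ h0s (le_refl s)
      hB hLs hu hε
    filter_upwards [h] with j hj
    refine hj.trans (le_of_eq ?_)
    rw [abs_of_nonneg (sub_nonneg.2 h0s)]
    ring
  · have hA : ∀ (ω : InfVolFermionState 2) (Ls' : ℕ → ℕ), Tendsto Ls' atTop atTop →
        ω.IsTorusLimitOfMixture (sectorGibbsCount n) (fun L => sectorGibbsWeightTT' β t s U n L)
          (fun L => sectorGibbsVectorTT' t s U n L) Ls' →
        ω.meanEnergy (hubbardTTPrimeFermionInteraction 0 1 0) 1 ≤ 16 / Real.pi ^ 2 :=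
      fun ω Ls' hLs' hω =>
        (abs_le.1 (hω.abs_meanEnergy_diagHop_le_of_sectorGibbs t s U hn0 hn2 β hLs')).2
    have h := eventually_log_partitionFn_sector_le_mul_sq_of_word_left hn0 hn2.le hβ (le_refl s) hs0
      hA hLs hu hε
    filter_upwards [h] with j hj
    refine hj.trans (le_of_eq ?_)
    rw [abs_of_nonpos (sub_nonpos.2 hs0)]
    ring

/-- **The hot chord on the whole `t'`-box from inputs at ONE anchor, kinematic price `16/π²`
(`ε`-free).** Eventual inputs `ℓ·L² ≤ log Z_{L,β}(t,s₀,U)` and `log Z_{L,β_h}(t,s₀,U) ≤ u_h·L²`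
(`0 < β_h < β`, `0 ≤ n < 2`) give, for every thermal torus limit `ω` at `(β, t, s, U, n)` along the
same tori, `e_{Φ(t,s,U)}(ω) ≤ (u_h − ℓ + (β + β_h)(16/π²)|s − s₀|)/(β − β_h)` (the two kinematic
transports above for every `ε > 0`, the hot chord
`IsTorusLimitOfMixture.meanEnergy_hubbardTTPrime_le_chord_of_sectorGibbs`, and `ε → 0`). Against
`…le_chord_of_anchor_inputs` (§8, price `4n(β + β_h)|s − s₀|`).
[cite: Ruelle1969, §2.5] [cite: Lieb1973, §V (5.2)–(5.4)] [cite: LiebLoss1993, §8, Theorem 8.2] -/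
theorem IsTorusLimitOfMixture.meanEnergy_hubbardTTPrime_le_chord_of_anchor_inputs_sixteen_div_pi_sq
    (hn0 : 0 ≤ n) (hn2 : n < 2) (t U s₀ s : ℝ) {β βh : ℝ} (hβh : 0 < βh) (hlt : βh < β)
    {ω : InfVolFermionState 2} {Ls : ℕ → ℕ}
    (h : ω.IsTorusLimitOfMixture (sectorGibbsCount n) (fun L => sectorGibbsWeightTT' β t s U n L)
      (fun L => sectorGibbsVectorTT' t s U n L) Ls) (hLs : Tendsto Ls atTop atTop) {ℓ uh : ℝ}
    (hℓ : ∀ᶠ j in atTop, ℓ * (Ls j : ℝ) ^ 2 ≤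
      Real.log (partitionFn β (sectorHamiltonianTT' t s₀ U n (Ls j))).re)
    (huh : ∀ᶠ j in atTop, Real.log (partitionFn βh (sectorHamiltonianTT' t s₀ U n (Ls j))).re ≤
      uh * (Ls j : ℝ) ^ 2) :
    ω.meanEnergy (hubbardTTPrimeFermionInteraction t s U) 1 ≤
      (uh - ℓ + (β + βh) * (16 / Real.pi ^ 2) * |s - s₀|) / (β - βh) := by
  have hβ : 0 < β := hβh.trans hlt
  have key : ∀ ε : ℝ, 0 < ε → ω.meanEnergy (hubbardTTPrimeFermionInteraction t s U) 1 ≤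
      (uh + βh * |s - s₀| * (16 / Real.pi ^ 2 + ε) -
        (ℓ - β * |s - s₀| * (16 / Real.pi ^ 2 + ε))) / (β - βh) := fun ε hε =>
    h.meanEnergy_hubbardTTPrime_le_chord_of_sectorGibbs hn0 hn2.le hLs hβh hlt
      (eventually_mul_sq_le_log_partitionFn_sector_of_tPrime_sixteen_div_pi_sq hn0 hn2 t U hβ s₀ s
        hLs hℓ hε)
      (eventually_log_partitionFn_sector_le_mul_sq_of_tPrime_sixteen_div_pi_sq hn0 hn2 t U hβh s₀ s
        hLs huh hε)
  refine le_of_forall_pos_le_add fun δ hδ => ?_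
  obtain ⟨ε, hε, hKε⟩ := exists_pos_mul_lt hδ ((β + βh) * |s - s₀| / (β - βh))
  have hk := key ε hε
  have hsplit : (uh + βh * |s - s₀| * (16 / Real.pi ^ 2 + ε) -
      (ℓ - β * |s - s₀| * (16 / Real.pi ^ 2 + ε))) / (β - βh) =
      (uh - ℓ + (β + βh) * (16 / Real.pi ^ 2) * |s - s₀|) / (β - βh) +
        (β + βh) * |s - s₀| / (β - βh) * ε := by
    ring
  linarith

end KinematicSixteen

end InfVolFermionState

end Literature.MathematicalPhysics.QuantumLattice

end
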